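import Literature.NumberTheory.DiophantineGeometry.BelyiDegreeFourPreliminaries
import Literature.NumberTheory.DiophantineGeometry.BelyiComposition
import HarnessLib

/-!
# Elliptic curves of Belyi degree `4` have `j ∈ {1728, 207646/6561}`

Topic `NumberTheory/DiophantineGeometry`; sequel to `BelyiDegreeThreeJZero.lean` and
`BelyiDegreeFourPreliminaries.lean` in the orbit of the named fact
`javanpeykar2014_stableFaltingsHeight_le`. Zapponi, [cite: Zapponi2009BelyiDegree, Example 1.2]:
"There are two isomorphism classes of elliptic curves with Belyi degree `4`, corresponding to
`j = 1728` and `j = 207646/6561`." This file proves the implication **`K̄(E)` has a Belyi function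
of degree `4` ⇒ `j(E) = 1728` or `j(E) = 207646/6561`** (`E/K`, `char K = 0`):
`j_eq_of_isBelyiFunction_of_finrank_eq_four`, `j_eq_of_belyiDegree_eq_four`. Together with
`BelyiDegreeGenusZero` (`deg_B ≤ 2 ⇔ ℙ¹`), `BelyiDegreeThreeJZero` (`deg_B = 3 ↔ j = 0`,
`deg_B(j = 1728) = 4`) this formalizes all "⇒" directions of Zapponi's Example 1.2 (the curves of
Belyi degree `≤ 4`); the existence of a degree-`4` Belyi map on `j = 207646/6561` (Zapponi §2.4,
`f = (x² - 6x + 4545 + 6y)/8748` on `y² = (x + 42)(x² - 42x + 3033)`) is not verified here.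
The appended `Main`-section lemmas `j_eq_of_belyiDegree_baseChange_eq_four`,
`j_mem_of_belyiDegree_baseChange_le_four`, `five_le_belyiDegree_baseChange` restate this for the
quantity `deg_B(E_Ω)` of the named fact (any algebraic closure `Ω`; number fields).
Everything is proved; no named fact is introduced.

## Proof (sketch)

The fibres over `0, 1, ∞` of a degree-`4` Belyi function `f` contain `4` places, two of them being
single places of multiplicity `4` (`BelyiDegreeFour.fibres_of_finrank_eq_four`); replacing `f` by
`1 - f` or `1 - 1/f` these sit over `∞` and `0`, and translating, the pole is `O`:
`f = a + bx + cy + dx²`, `d ≠ 0` (`L(4 O)`). If `c = 0` then `f = d(x - r)²` and `r, r ± δ`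
(`δ² = 1/d`) are the `x`-coordinates of the three points of order `2`, whence `b₂ = -12r`,
`b₄ = 6r² - 2δ²`, `b₆ = -4r(r² - δ²)` and `j = 1728`. If `c ≠ 0`, `u = f/c = y - L(x)` with `L`
quadratic has norm `N₀ = L² + (a₁X + a₃)L - (X³ + a₂X² + a₄X + a₆) = l₂²(X - e₀)⁴` (`e₀ = x(P₀)`,
using the negation `[-1]^*` to control the conjugate `ū`), and over `1` the norm
`N₁ = N₀ + t(2L + a₁X + a₃) + t²` (`t = 1/c`) is `l₂²(X - α)(X - β)³` — the patterns `(2,2)` and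
`(4)` being incompatible with the `X³`-coefficient `2l₂m₁ + a₁l₂ = 1` — and eliminating gives
`6561 c₄³ = 207646 Δ`.

## References

* L. Zapponi, *On the Belyi degree(s) of a curve defined over a number field*, arXiv:0904.0967
  (2009), Example 1.2, §2.4. [Zapponi2009BelyiDegree]
* J. H. Silverman, *The Arithmetic of Elliptic Curves*, 2nd ed., GTM 106, Springer 2009, III.§1,
  Prop. III.3.1, Group Law Algorithm III.2.3. [SilvermanAEC2009]
-/

noncomputable section

open scoped Classical IntermediateField Polynomial.Bivariate
open Polynomial WeierstrassCurve
open Literature.NumberTheory.EllipticCurves.WeierstrassFunctionField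
open Literature.Computability.Cryptography.Csidh

universe u

namespace Literature.NumberTheory.DiophantineGeometry

open AlgFunctionField BelyiDegreeThreeJZero BelyiDegreeFour

namespace BelyiDegreeFourJ

/-! ### §0 The coefficient algebra -/

/-- `4Δ` as a polynomial in `b₂, b₄, b₆` (via `4b₈ = b₂b₆ - b₄²`).
[cite: SilvermanAEC2009, III.§1] -/
theorem four_mul_Δ {k : Type*} [CommRing k] (V : WeierstrassCurve k) :
    4 * V.Δ = -V.b₂ ^ 2 * (V.b₂ * V.b₆ - V.b₄ ^ 2) - 32 * V.b₄ ^ 3 - 108 * V.b₆ ^ 2 +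
      36 * V.b₂ * V.b₄ * V.b₆ := by
  rw [WeierstrassCurve.Δ]; linear_combination (-V.b₂ ^ 2) * V.b_relation

/-- **`c = 0`: three points of order two at `x = r, r ± δ` force `j = 1728`** (`c₄³ = 1728 Δ`):
the `2`-division cubic `4X³ + b₂X² + 2b₄X + b₆` vanishes at `r, r + δ, r - δ` (`δ ≠ 0`), so
`b₂ = -12r`, `b₄ = 6r² - 2δ²`, `b₆ = -4r(r² - δ²)`. [cite: Zapponi2009BelyiDegree, Example 1.2] -/
theorem c₄_cube_eq_of_three_roots {k : Type*} [Field k] [CharZero k] (V : WeierstrassCurve k)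
    {r δ : k} (hδ : δ ≠ 0) (h0 : 4 * r ^ 3 + V.b₂ * r ^ 2 + 2 * V.b₄ * r + V.b₆ = 0)
    (h1 : 4 * (r + δ) ^ 3 + V.b₂ * (r + δ) ^ 2 + 2 * V.b₄ * (r + δ) + V.b₆ = 0)
    (h2 : 4 * (r - δ) ^ 3 + V.b₂ * (r - δ) ^ 2 + 2 * V.b₄ * (r - δ) + V.b₆ = 0) :
    V.c₄ ^ 3 = 1728 * V.Δ := by
  have hb₂ : V.b₂ = -12 * r := by
    have e : (2 * δ ^ 2) * (V.b₂ + 12 * r) = 0 := by linear_combination h1 + h2 - 2 * h0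
    have : V.b₂ + 12 * r = 0 :=
      (mul_eq_zero.1 e).resolve_left (mul_ne_zero two_ne_zero (pow_ne_zero 2 hδ))
    linear_combination this
  have hb₄ : V.b₄ = 6 * r ^ 2 - 2 * δ ^ 2 := by
    have e : (2 * δ) * (12 * r ^ 2 + 4 * δ ^ 2 + 2 * V.b₂ * r + 2 * V.b₄) = 0 := by
      linear_combination h1 - h2
    have h' : 12 * r ^ 2 + 4 * δ ^ 2 + 2 * V.b₂ * r + 2 * V.b₄ = 0 :=
      (mul_eq_zero.1 e).resolve_left (mul_ne_zero two_ne_zero hδ)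
    rw [hb₂] at h'
    linear_combination h' / 2
  have hb₆ : V.b₆ = -4 * r * (r ^ 2 - δ ^ 2) := by
    rw [hb₂, hb₄] at h0
    linear_combination h0
  have h4Δ := four_mul_Δ V
  rw [WeierstrassCurve.c₄]
  simp only [hb₂, hb₄, hb₆] at h4Δ ⊢
  linear_combination (-(1728 / 4) : k) * h4Δ

/-- The final identity of the pattern `(1, 3)`: if the translated invariants satisfy
`b₂ + 12e = (208/9)s`, `b₄ + e b₂ + 6e² = (256/9)s²`, `b₆ + 2e b₄ + e² b₂ + 4e³ = (1024/9)s³` then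
`6561 c₄³ = 207646 Δ` (`j = 207646/6561 = 2·47³/3⁸`). [cite: Zapponi2009BelyiDegree, §2.4] -/
theorem c₄_cube_eq_of_translated {k : Type*} [Field k] [CharZero k] (V : WeierstrassCurve k)
    {s e : k} (hb₂ : V.b₂ + 12 * e = 4 * (52 / 9 * s))
    (hb₄ : V.b₄ + e * V.b₂ + 6 * e ^ 2 = 2 * (128 / 9 * s ^ 2))
    (hb₆ : V.b₆ + 2 * e * V.b₄ + e ^ 2 * V.b₂ + 4 * e ^ 3 = 4 * (256 / 9 * s ^ 3)) :
    6561 * V.c₄ ^ 3 = 207646 * V.Δ := by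
  have h4Δ := four_mul_Δ V
  have e₂ : V.b₂ = 208 / 9 * s - 12 * e := by linear_combination hb₂
  have e₄ : V.b₄ = 256 / 9 * s ^ 2 - e * V.b₂ - 6 * e ^ 2 := by linear_combination hb₄
  have e₆ : V.b₆ = 1024 / 9 * s ^ 3 - 2 * e * V.b₄ - e ^ 2 * V.b₂ - 4 * e ^ 3 := by
    linear_combination hb₆
  rw [e₂] at e₄; rw [e₂, e₄] at e₆
  rw [WeierstrassCurve.c₄]
  simp only [e₂, e₄, e₆] at h4Δ ⊢
  linear_combination (-(207646 / 4) : k) * h4Δ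

/-- **Pattern `(1, 3)` ⇒ `6561 c₄³ = 207646 Δ`.** The eight coefficient identities of the proof (in
the coordinate `Z = X - e₀`: `L = l₂Z² + m₁Z + m₀`, translated curve coefficients
`a₃' = a₃ + e₀a₁`, `A₂ = a₂ + 3e₀`, `A₄ = a₄ + 2e₀a₂ + 3e₀²`, `A₆ = a₆ + e₀a₄ + e₀²a₂ + e₀³`):
`N₀ = l₂²Z⁴` (`H3–H0`) and `N₀ + t(2L + a₁Z + a₃') + t² = l₂²(Z - α)(Z - β)³` (`G3–G0`), with
`l₂, t ≠ 0`, force `α = -3β`, `t = -3l₂β²`, `2m₁ + a₁ = -(8/3)l₂β`, `2m₀ + a₃' = 4l₂β²`,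
`l₂²β = -3/8`, and then the translated `b`-invariants of `c₄_cube_eq_of_translated` with
`s = l₂²β²`. [cite: Zapponi2009BelyiDegree, Example 1.2] -/
theorem c₄_cube_eq_of_pattern13 {k : Type*} [Field k] [CharZero k] (V : WeierstrassCurve k)
    {l₂ m₁ m₀ e₀ t α β : k} (hl : l₂ ≠ 0) (ht : t ≠ 0)
    (H3 : 2 * l₂ * m₁ + V.a₁ * l₂ - 1 = 0)
    (H2 : m₁ ^ 2 + 2 * l₂ * m₀ + V.a₁ * m₁ + (V.a₃ + e₀ * V.a₁) * l₂ - (V.a₂ + 3 * e₀) = 0)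
    (H1 : 2 * m₁ * m₀ + V.a₁ * m₀ + (V.a₃ + e₀ * V.a₁) * m₁ -
      (V.a₄ + 2 * e₀ * V.a₂ + 3 * e₀ ^ 2) = 0)
    (H0 : m₀ ^ 2 + (V.a₃ + e₀ * V.a₁) * m₀ - (V.a₆ + e₀ * V.a₄ + e₀ ^ 2 * V.a₂ + e₀ ^ 3) = 0)
    (G3 : l₂ ^ 2 * (α + 3 * β) = 0)
    (G2 : 2 * t * l₂ = l₂ ^ 2 * (3 * α * β + 3 * β ^ 2))
    (G1 : t * (2 * m₁ + V.a₁) = -(l₂ ^ 2 * (3 * α * β ^ 2 + β ^ 3)))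
    (G0 : t * (2 * m₀ + (V.a₃ + e₀ * V.a₁)) + t ^ 2 = l₂ ^ 2 * (α * β ^ 3)) :
    6561 * V.c₄ ^ 3 = 207646 * V.Δ := by
  have hα : α = -3 * β := by
    have : α + 3 * β = 0 := (mul_eq_zero.1 G3).resolve_left (pow_ne_zero 2 hl)
    linear_combination this
  subst hα
  have htβ : t = -3 * l₂ * β ^ 2 := by
    have e : l₂ * (2 * t + 6 * l₂ * β ^ 2) = 0 := by linear_combination G2
    have := (mul_eq_zero.1 e).resolve_left hl
    linear_combination this / 2
  have hβ : β ≠ 0 := by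
    rintro rfl
    apply ht
    rw [htβ]; ring
  have h3 : (-3 * l₂ * β ^ 2) ≠ 0 := mul_ne_zero (mul_ne_zero (by norm_num) hl) (pow_ne_zero 2 hβ)
  have hm₁ : 2 * m₁ + V.a₁ = -(8 / 3) * l₂ * β := by
    rw [htβ] at G1
    have e : (-3 * l₂ * β ^ 2) * ((2 * m₁ + V.a₁) + 8 / 3 * l₂ * β) = 0 := by
      linear_combination G1
    linear_combination (mul_eq_zero.1 e).resolve_left h3
  have hm₀ : 2 * m₀ + (V.a₃ + e₀ * V.a₁) = 4 * l₂ * β ^ 2 := by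
    rw [htβ] at G0
    have e : (-3 * l₂ * β ^ 2) * ((2 * m₀ + (V.a₃ + e₀ * V.a₁)) - 4 * l₂ * β ^ 2) = 0 := by
      linear_combination G0
    linear_combination (mul_eq_zero.1 e).resolve_left h3
  have hs : l₂ ^ 2 * β = -3 / 8 := by
    have e : l₂ * (2 * m₁ + V.a₁) = 1 := by linear_combination H3
    rw [hm₁] at e
    linear_combination -(3 / 8) * e
  have em₁ : m₁ = -(4 / 3) * l₂ * β - V.a₁ / 2 := by linear_combination hm₁ / 2
  have em₀ : m₀ = 2 * l₂ * β ^ 2 - (V.a₃ + e₀ * V.a₁) / 2 := by linear_combination hm₀ / 2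
  have hb₂ : V.b₂ + 12 * e₀ = 4 * (52 / 9 * (l₂ ^ 2 * β ^ 2)) := by
    rw [WeierstrassCurve.b₂]
    rw [em₁, em₀] at H2
    linear_combination -4 * H2
  have hb₄ : V.b₄ + e₀ * V.b₂ + 6 * e₀ ^ 2 = 2 * (128 / 9 * (l₂ ^ 2 * β ^ 2) ^ 2) := by
    rw [WeierstrassCurve.b₄, WeierstrassCurve.b₂]
    rw [em₁, em₀] at H1
    linear_combination (-2) * H1 - (256 / 9) * l₂ ^ 2 * β ^ 3 * hs
  have hb₆ : V.b₆ + 2 * e₀ * V.b₄ + e₀ ^ 2 * V.b₂ + 4 * e₀ ^ 3 =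
      4 * (256 / 9 * (l₂ ^ 2 * β ^ 2) ^ 3) := by
    rw [WeierstrassCurve.b₆, WeierstrassCurve.b₄, WeierstrassCurve.b₂]
    rw [em₀] at H0
    linear_combination (-4) * H0 - (1024 / 9) * l₂ ^ 2 * β ^ 4 * (l₂ ^ 2 * β - 3 / 8) * hs
  exact c₄_cube_eq_of_translated V hb₂ hb₄ hb₆

/-- **Pattern `(2, 2)` is impossible**: `N₀ + t(2L + a₁Z + a₃') + t² = l₂²(Z - α)²(Z - β)²`
forces `α + β = 0` and `2m₁ + a₁ = 0`, contradicting `l₂(2m₁ + a₁) = 1` (`H3`).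
[cite: Zapponi2009BelyiDegree, Example 1.2] -/
theorem false_of_pattern22 {k : Type*} [Field k] [CharZero k] (V : WeierstrassCurve k)
    {l₂ m₁ t α β : k} (hl : l₂ ≠ 0) (ht : t ≠ 0)
    (H3 : 2 * l₂ * m₁ + V.a₁ * l₂ - 1 = 0)
    (G3 : l₂ ^ 2 * (2 * α + 2 * β) = 0)
    (G1 : t * (2 * m₁ + V.a₁) = -(l₂ ^ 2 * (2 * α * β ^ 2 + 2 * α ^ 2 * β))) : False := by
  have hα : α = -β := by
    have : 2 * α + 2 * β = 0 := (mul_eq_zero.1 G3).resolve_left (pow_ne_zero 2 hl)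
    linear_combination this / 2
  subst hα
  have hm : 2 * m₁ + V.a₁ = 0 := by
    have e : t * (2 * m₁ + V.a₁) = 0 := by linear_combination G1
    exact (mul_eq_zero.1 e).resolve_left ht
  have : (1 : k) = 0 := by linear_combination -H3 + l₂ * hm
  exact one_ne_zero this

/-- **Pattern `(4)` is impossible**: `N₀ + t(2L + a₁Z + a₃') + t² = l₂²(Z - α)⁴` forces `α = 0`
and then `2tl₂ = 0`. [cite: Zapponi2009BelyiDegree, Example 1.2] -/
theorem false_of_pattern4 {k : Type*} [Field k] [CharZero k] {l₂ t α : k} (hl : l₂ ≠ 0)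
    (ht : t ≠ 0) (G3 : l₂ ^ 2 * (4 * α) = 0) (G2 : 2 * t * l₂ = l₂ ^ 2 * (6 * α ^ 2)) : False := by
  have hα : α = 0 := by
    have : 4 * α = 0 := (mul_eq_zero.1 G3).resolve_left (pow_ne_zero 2 hl)
    linear_combination this / 4
  subst hα
  have : 2 * t * l₂ = 0 := by rw [G2]; ring
  exact mul_ne_zero (mul_ne_zero two_ne_zero ht) hl this

/-! ### §1 Norms of `y - L(x)` and the negation `[-1]^*` on `K̄(E)` -/

/-- **The norm of `u = y - L(x)` for any polynomial `L`**: with the conjugate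
`ū = -y - a₁x - a₃ - L(x)`, `u ū = N_L(x)` where `N_L = L² + (a₁X + a₃)L - (X³ + a₂X² + a₄X + a₆)`
(any solution `(x, y)` of the Weierstrass equation in a `k`-algebra).
[cite: SilvermanAEC2009, III.§1] -/
theorem sub_aeval_mul_conj {k F : Type*} [Field k] [CommRing F] [Algebra k F]
    (V : WeierstrassCurve k)
    {x y : F} (heq : y ^ 2 + algebraMap k F V.a₁ * x * y + algebraMap k F V.a₃ * y -
      (x ^ 3 + algebraMap k F V.a₂ * x ^ 2 + algebraMap k F V.a₄ * x + algebraMap k F V.a₆) = 0)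
    (L : k[X]) :
    (y - aeval x L) * (-y - algebraMap k F V.a₁ * x - algebraMap k F V.a₃ - aeval x L) =
      aeval x (L ^ 2 + (C V.a₁ * X + C V.a₃) * L -
        (X ^ 3 + C V.a₂ * X ^ 2 + C V.a₄ * X + C V.a₆)) := by
  simp only [map_add, map_sub, map_mul, map_pow, aeval_X, aeval_C]
  linear_combination (-1 : F) * heq

section Negation

variable {K : Type u} [Field K] [CharZero K] {W : WeierstrassCurve K} [W.IsElliptic]

omit [CharZero K] in
/-- **The negation `[-1]^*` of `K̄(E)` fixes `x` and sends `y ↦ -y - a₁x - a₃`** (it maps the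
generic point to its negative). [cite: SilvermanAEC2009, Group Law Algorithm III.2.3] -/
theorem pullbackHom_neg_genX_genY :
    (Isogeny.zsmul W (-1) (by norm_num)).pullbackHom W.genX = W.genX ∧
      (Isogeny.zsmul W (-1) (by norm_num)).pullbackHom W.genY =
        -W.genY - algebraMap (AlgebraicClosure K) W.geomFunctionField
            ((W.baseChange (AlgebraicClosure K)).a₁) * W.genX -
          algebraMap (AlgebraicClosure K) W.geomFunctionField
            ((W.baseChange (AlgebraicClosure K)).a₃) := by
  have h := map_pullbackHom_zsmul_genericPoint (W := W) (m := -1) (by norm_num)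
  rw [neg_one_zsmul, WeierstrassCurve.genericPoint, Affine.Point.neg_some, Affine.Point.map_some,
    Affine.Point.some.injEq] at h
  refine ⟨h.1, ?_⟩
  rw [h.2, Affine.negY]
  rfl

/-- **`ord_P([-1]^* u) = ord_{-P}(u)`** (`[-1]` is an unramified automorphism).
[cite: SilvermanAEC2009, III.§4] -/
theorem ordAt_pullbackHom_neg (P : W.geomPoints) (u : W.geomFunctionField) :
    W.ordAt P ((Isogeny.zsmul W (-1) (by norm_num)).pullbackHom u) = W.ordAt (-P) u := by
  rw [Isogeny.ordAt_pullbackHom_zsmul (by norm_num) (by norm_num), neg_one_zsmul]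

omit [CharZero K] in
/-- **The conjugate of `u = y - L(x)` is `[-1]^* u`**: `[-1]^*(y - L(x)) = -y - a₁x - a₃ - L(x)`.
[cite: SilvermanAEC2009, III.§2] -/
theorem pullbackHom_neg_sub_aeval (L : (AlgebraicClosure K)[X]) :
    (Isogeny.zsmul W (-1) (by norm_num)).pullbackHom (W.genY - aeval W.genX L) =
      -W.genY - algebraMap (AlgebraicClosure K) W.geomFunctionField
          ((W.baseChange (AlgebraicClosure K)).a₁) * W.genX -
        algebraMap (AlgebraicClosure K) W.geomFunctionField
          ((W.baseChange (AlgebraicClosure K)).a₃) - aeval W.genX L := by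
  obtain ⟨hx, hy⟩ := pullbackHom_neg_genX_genY (W := W)
  rw [map_sub, hy, ← aeval_algHom_apply, hx]

/-- Hence **`ord_P(ū) = ord_{-P}(u)`** for `u = y - L(x)`, `ū = -y - a₁x - a₃ - L(x)`.
[cite: SilvermanAEC2009, III.§2] -/
theorem ordAt_conj (P : W.geomPoints) (L : (AlgebraicClosure K)[X]) :
    W.ordAt P (-W.genY - algebraMap (AlgebraicClosure K) W.geomFunctionField
          ((W.baseChange (AlgebraicClosure K)).a₁) * W.genX -
        algebraMap (AlgebraicClosure K) W.geomFunctionField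
          ((W.baseChange (AlgebraicClosure K)).a₃) - aeval W.genX L) =
      W.ordAt (-P) (W.genY - aeval W.genX L) := by
  rw [← pullbackHom_neg_sub_aeval, ordAt_pullbackHom_neg]

end Negation

/-! ### §2a The zero fibre: `N_L = l₂²(X - e₀)⁴` -/

section FunctionField

variable {K : Type u} [Field K] [CharZero K] {W : WeierstrassCurve K} [W.IsElliptic]

/-- The norm polynomial `N_L = L² + (a₁X + a₃)L - (X³ + a₂X² + a₄X + a₆)` of `u = y - L(x)`,
recentred at `e₀`: with `L(X + e₀) = l₂X² + m₁X + m₀`, the translated coefficients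
`a₃' = a₃ + e₀a₁`, `A₂ = a₂ + 3e₀`, `A₄ = a₄ + 2e₀a₂ + 3e₀²`, `A₆ = a₆ + e₀a₄ + e₀²a₂ + e₀³` appear.
[folklore] -/
theorem norm_comp_X_add_C {k : Type*} [CommRing k] (V : WeierstrassCurve k)
    (l₂ l₁ l₀ e₀ : k) :
    ((C l₂ * X ^ 2 + C l₁ * X + C l₀) ^ 2 +
          (C V.a₁ * X + C V.a₃) * (C l₂ * X ^ 2 + C l₁ * X + C l₀) -
        (X ^ 3 + C V.a₂ * X ^ 2 + C V.a₄ * X + C V.a₆)).comp (X + C e₀) =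
      C (l₂ ^ 2) * X ^ 4 +
        C (2 * l₂ * (l₁ + 2 * l₂ * e₀) + V.a₁ * l₂ - 1) * X ^ 3 +
        C ((l₁ + 2 * l₂ * e₀) ^ 2 + 2 * l₂ * (l₂ * e₀ ^ 2 + l₁ * e₀ + l₀) +
            V.a₁ * (l₁ + 2 * l₂ * e₀) + (V.a₃ + e₀ * V.a₁) * l₂ - (V.a₂ + 3 * e₀)) * X ^ 2 +
        C (2 * (l₁ + 2 * l₂ * e₀) * (l₂ * e₀ ^ 2 + l₁ * e₀ + l₀) +
            V.a₁ * (l₂ * e₀ ^ 2 + l₁ * e₀ + l₀) + (V.a₃ + e₀ * V.a₁) * (l₁ + 2 * l₂ * e₀) -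
            (V.a₄ + 2 * e₀ * V.a₂ + 3 * e₀ ^ 2)) * X +
        C ((l₂ * e₀ ^ 2 + l₁ * e₀ + l₀) ^ 2 + (V.a₃ + e₀ * V.a₁) * (l₂ * e₀ ^ 2 + l₁ * e₀ + l₀) -
            (V.a₆ + e₀ * V.a₄ + e₀ ^ 2 * V.a₂ + e₀ ^ 3)) := by
  simp only [sub_comp, add_comp, mul_comp, pow_comp, X_comp, C_comp, map_add, map_sub, map_mul,
    map_pow, map_ofNat, map_one]
  ring

/-- **The zero fibre of `u = y - L(x)` (`L` quadratic, `l₂ ≠ 0`) with divisor `4P₀ - 4O`,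
`P₀ = (e₀, b₀)`, forces `N_L(X + e₀) = l₂²X⁴`**: `P₀` is not of order `2` (else `u = λ(x - e₀)²`
would put `y` in `K̄(x)`), so `v_{P₀}(x - e₀) = 1` and `v_{P₀}(ū) = v_{-P₀}(u) = 0`; hence
`v_{P₀}(N_L(x)) = 4` and `(X - e₀)⁴ ∣ N_L`. Output: the four coefficient identities `H3–H0` of
`c₄_cube_eq_of_pattern13` (with `m₁ = l₁ + 2l₂e₀`, `m₀ = L(e₀)`).
[cite: Zapponi2009BelyiDegree, Example 1.2] -/
theorem zero_fibre_coeffs {l₂ l₁ l₀ e₀ b₀ : AlgebraicClosure K}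
    (h : (W.baseChange (AlgebraicClosure K)).toAffine.Nonsingular e₀ b₀)
    (hu0 : W.ordAt 0 (W.genY - aeval W.genX (C l₂ * X ^ 2 + C l₁ * X + C l₀)) = -4)
    (huP : W.ordAt (.some e₀ b₀ h) (W.genY - aeval W.genX (C l₂ * X ^ 2 + C l₁ * X + C l₀)) = 4)
    (huR : ∀ R : W.geomPoints, R ≠ 0 → R ≠ .some e₀ b₀ h →
      W.ordAt R (W.genY - aeval W.genX (C l₂ * X ^ 2 + C l₁ * X + C l₀)) = 0) :
    (W.baseChange (AlgebraicClosure K)).toAffine.negY e₀ b₀ ≠ b₀ ∧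
    W.ordAt (.some e₀ b₀ h) (W.genX - algebraMap _ W.geomFunctionField e₀) = 1 ∧
    (2 * l₂ * (l₁ + 2 * l₂ * e₀) + (W.baseChange (AlgebraicClosure K)).a₁ * l₂ - 1 = 0 ∧
      (l₁ + 2 * l₂ * e₀) ^ 2 + 2 * l₂ * (l₂ * e₀ ^ 2 + l₁ * e₀ + l₀) +
          (W.baseChange (AlgebraicClosure K)).a₁ * (l₁ + 2 * l₂ * e₀) +
          ((W.baseChange (AlgebraicClosure K)).a₃ + e₀ * (W.baseChange (AlgebraicClosure K)).a₁) *
            l₂ - ((W.baseChange (AlgebraicClosure K)).a₂ + 3 * e₀) = 0 ∧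
      2 * (l₁ + 2 * l₂ * e₀) * (l₂ * e₀ ^ 2 + l₁ * e₀ + l₀) +
          (W.baseChange (AlgebraicClosure K)).a₁ * (l₂ * e₀ ^ 2 + l₁ * e₀ + l₀) +
          ((W.baseChange (AlgebraicClosure K)).a₃ + e₀ * (W.baseChange (AlgebraicClosure K)).a₁) *
            (l₁ + 2 * l₂ * e₀) -
          ((W.baseChange (AlgebraicClosure K)).a₄ +
            2 * e₀ * (W.baseChange (AlgebraicClosure K)).a₂ + 3 * e₀ ^ 2) = 0 ∧
      (l₂ * e₀ ^ 2 + l₁ * e₀ + l₀) ^ 2 +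
          ((W.baseChange (AlgebraicClosure K)).a₃ + e₀ * (W.baseChange (AlgebraicClosure K)).a₁) *
            (l₂ * e₀ ^ 2 + l₁ * e₀ + l₀) -
          ((W.baseChange (AlgebraicClosure K)).a₆ + e₀ * (W.baseChange (AlgebraicClosure K)).a₄ +
            e₀ ^ 2 * (W.baseChange (AlgebraicClosure K)).a₂ + e₀ ^ 3) = 0) := by
  set L : (AlgebraicClosure K)[X] := C l₂ * X ^ 2 + C l₁ * X + C l₀ with hL
  set P : W.geomPoints := .some e₀ b₀ h with hPdef
  set u : W.geomFunctionField := W.genY - aeval W.genX L with hudef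
  have hP0 : P ≠ 0 := Affine.Point.some_ne_zero h
  have hune : u ≠ 0 := by
    intro h0; rw [h0, ordAt_zero_right] at huP; exact absurd huP (by norm_num)
  have hxne : W.genX - algebraMap (AlgebraicClosure K) W.geomFunctionField e₀ ≠ 0 := fun h0 ↦
    transcendental_genX W ((sub_eq_zero.1 h0) ▸ isAlgebraic_algebraMap e₀)
  -- (i) `P₀` is not a point of order `2`
  have hnot2 : (W.baseChange (AlgebraicClosure K)).toAffine.negY e₀ b₀ ≠ b₀ := by
    intro h2
    have hx2 := (ordAt_genX_sub_eq_two_iff (W := W) h).2 h2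
    obtain ⟨-, hxR⟩ := (ordAt_genX_sub_cases (W := W) h).resolve_left (by omega)
    -- `u` and `(x - e₀)²` have the same divisor
    have hall : ∀ R : W.geomPoints, W.ordAt R u =
        W.ordAt R ((W.genX - algebraMap (AlgebraicClosure K) W.geomFunctionField e₀) ^ 2) := by
      intro R
      rw [pow_two, ordAt_mul R hxne hxne]
      by_cases hR0 : R = 0
      · rw [hR0, hu0, ordAt_zero_genX_sub]; norm_num
      · by_cases hRP : R = P
        · rw [hRP, hPdef, huP, hx2]; norm_num
        · rw [huR R hR0 hRP, hxR R hR0 hRP]; norm_num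
    obtain ⟨c, -, hc⟩ := exists_eq_smul_of_ordAt_eq hune (pow_ne_zero 2 hxne) hall
    rw [Algebra.smul_def, hudef, hL] at hc
    have key : algebraMap _ W.geomFunctionField (-l₀ - c * e₀ ^ 2) +
        algebraMap _ W.geomFunctionField (-l₁ + 2 * c * e₀) * W.genX +
        algebraMap _ W.geomFunctionField (-l₂ - c) * W.genX ^ 2 +
        algebraMap (AlgebraicClosure K) W.geomFunctionField 0 * W.genX ^ 3 +
        (algebraMap (AlgebraicClosure K) W.geomFunctionField 1 +
          algebraMap (AlgebraicClosure K) W.geomFunctionField 0 * W.genX) * W.genY = 0 := by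
      simp only [map_add, map_sub, map_mul, map_neg, map_pow, map_ofNat, map_one, map_zero,
        aeval_X, aeval_C] at hc ⊢
      linear_combination hc
    obtain ⟨-, -, -, -, h1, -⟩ := coeffs_eq_zero_of_lin_eq_zero key
    exact one_ne_zero h1
  -- (ii) `ord_{P₀}(x - e₀) = 1`
  have hx1 : W.ordAt P (W.genX - algebraMap _ W.geomFunctionField e₀) = 1 := by
    rcases ordAt_genX_sub_cases (W := W) h with h1 | ⟨h2, -⟩
    · exact h1
    · exact absurd ((ordAt_genX_sub_eq_two_iff (W := W) h).1 h2) hnot2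
  -- (iii) the conjugate is a unit at `P₀`
  have hnegP : -P ≠ P := by
    change -(Affine.Point.some e₀ b₀ h : W.geomPoints) ≠ (Affine.Point.some e₀ b₀ h : W.geomPoints)
    rw [geomPoints.neg_some]
    intro heq
    rw [Affine.Point.some.injEq] at heq
    exact hnot2 heq.2
  have hconj : W.ordAt P (-W.genY -
      algebraMap _ W.geomFunctionField (W.baseChange (AlgebraicClosure K)).a₁ * W.genX -
      algebraMap _ W.geomFunctionField (W.baseChange (AlgebraicClosure K)).a₃ -
      aeval W.genX L) = 0 := by
    rw [ordAt_conj, ← hudef]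
    have hnP0 : -P ≠ 0 := fun h0 ↦ hP0 (neg_eq_zero.1 h0)
    exact huR (-P) hnP0 hnegP
  -- (iv) `ord_{P₀}(N_L(x)) = 4`
  set N : (AlgebraicClosure K)[X] := L ^ 2 +
    (C (W.baseChange (AlgebraicClosure K)).a₁ * X + C (W.baseChange (AlgebraicClosure K)).a₃) * L -
    (X ^ 3 + C (W.baseChange (AlgebraicClosure K)).a₂ * X ^ 2 +
      C (W.baseChange (AlgebraicClosure K)).a₄ * X + C (W.baseChange (AlgebraicClosure K)).a₆)
    with hNdef
  have hN : u * (-W.genY -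
      algebraMap _ W.geomFunctionField (W.baseChange (AlgebraicClosure K)).a₁ * W.genX -
      algebraMap _ W.geomFunctionField (W.baseChange (AlgebraicClosure K)).a₃ -
      aeval W.genX L) = aeval W.genX N :=
    sub_aeval_mul_conj (W.baseChange (AlgebraicClosure K)) equation_gen L
  have hubar0 : -W.genY -
      algebraMap _ W.geomFunctionField (W.baseChange (AlgebraicClosure K)).a₁ * W.genX -
      algebraMap _ W.geomFunctionField (W.baseChange (AlgebraicClosure K)).a₃ -
      aeval W.genX L ≠ 0 := by
    intro h0
    have key : algebraMap _ W.geomFunctionField (-(W.baseChange (AlgebraicClosure K)).a₃ - l₀) +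
        algebraMap _ W.geomFunctionField (-(W.baseChange (AlgebraicClosure K)).a₁ - l₁) * W.genX +
        algebraMap _ W.geomFunctionField (-l₂) * W.genX ^ 2 +
        algebraMap (AlgebraicClosure K) W.geomFunctionField 0 * W.genX ^ 3 +
        (algebraMap (AlgebraicClosure K) W.geomFunctionField (-1) +
          algebraMap (AlgebraicClosure K) W.geomFunctionField 0 * W.genX) * W.genY = 0 := by
      rw [hL] at h0
      simp only [map_add, map_sub, map_mul, map_neg, map_pow, map_one, map_zero, aeval_X,
        aeval_C] at h0 ⊢
      linear_combination h0
    obtain ⟨-, -, -, -, h1, -⟩ := coeffs_eq_zero_of_lin_eq_zero key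
    exact one_ne_zero (neg_eq_zero.1 h1)
  have hNx0 : aeval W.genX N ≠ 0 := by rw [← hN]; exact mul_ne_zero hune hubar0
  have hN0 : N ≠ 0 := by rintro h0; rw [h0, map_zero] at hNx0; exact hNx0 rfl
  have hordN : W.ordAt P (aeval W.genX N) = 4 := by
    rw [← hN, ordAt_mul P hune hubar0, huP, hconj]; norm_num
  -- (v) through the place `W.place P`: `X⁴ ∣ N(X + e₀)`
  have hpos :
      0 < (W.place P).ord (W.genX - algebraMap (AlgebraicClosure K) W.geomFunctionField e₀) := by
    rw [← ordAt_eq_ord_place P hxne, hx1]; exact one_pos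
  obtain ⟨-, hmult⟩ := (W.place P).ord_aeval_of_ord_sub_pos hpos hN0
  rw [← ordAt_eq_ord_place P hNx0, ← ordAt_eq_ord_place P hxne, hx1, mul_one, hordN] at hmult
  have h4 : 4 ≤ (N.comp (X + C e₀)).rootMultiplicity 0 := by exact_mod_cast hmult.le
  have hq0 : N.comp (X + C e₀) ≠ 0 := by
    intro h0
    rw [comp_eq_zero_iff] at h0
    rcases h0 with h0 | ⟨-, h0⟩
    · exact hN0 h0
    · have := congr_arg (fun q : (AlgebraicClosure K)[X] ↦ q.coeff 1) h0
      simp at this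
  have hdvd : X ^ 4 ∣ N.comp (X + C e₀) := by
    have := (le_rootMultiplicity_iff hq0).1 h4
    rwa [map_zero, sub_zero] at this
  rw [hNdef, hL, norm_comp_X_add_C] at hdvd
  have h3 := (X_pow_dvd_iff.1 hdvd) 3 (by norm_num)
  have h2 := (X_pow_dvd_iff.1 hdvd) 2 (by norm_num)
  have h1 := (X_pow_dvd_iff.1 hdvd) 1 (by norm_num)
  have h0 := (X_pow_dvd_iff.1 hdvd) 0 (by norm_num)
  simp only [coeff_add, coeff_C_mul, coeff_X_pow, coeff_X, coeff_C] at h3 h2 h1 h0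
  norm_num at h3 h2 h1 h0
  exact ⟨hnot2, hx1, h3, h2, h1, h0⟩

/-! ### §2b The fibre over `1`: multiplicities of the norm -/

/-- **Multiplicities of the norm at a zero.** For `u = y - L(x)` and an affine zero `R = (γ, c)`
with `v_R(u) = n`, such that `v_{-R}(u) = 0` unless `-R = R`: `(X - γ)ⁿ ∣ N_L`. (If `R` has order
`2` then `v_R(x - γ) = 2` and `v_R(N_L(x)) = v_R(u) + v_{-R}(u) = 2n`; otherwise `v_R(x - γ) = 1`
and `v_R(N_L(x)) = n`.)
[cite: SilvermanAEC2009, Prop. II.2.6(a)] -/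
theorem X_sub_C_pow_dvd_norm {L : (AlgebraicClosure K)[X]} {γ c : AlgebraicClosure K}
    (h : (W.baseChange (AlgebraicClosure K)).toAffine.Nonsingular γ c) {n : ℕ}
    (hu : W.genY - aeval W.genX L ≠ 0)
    (hn : W.ordAt (.some γ c h) (W.genY - aeval W.genX L) = n)
    (hneg : -(Affine.Point.some γ c h : W.geomPoints) ≠ .some γ c h →
      W.ordAt (-(Affine.Point.some γ c h : W.geomPoints)) (W.genY - aeval W.genX L) = 0) :
    (X - C γ) ^ n ∣ L ^ 2 + (C (W.baseChange (AlgebraicClosure K)).a₁ * X +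
      C (W.baseChange (AlgebraicClosure K)).a₃) * L -
      (X ^ 3 + C (W.baseChange (AlgebraicClosure K)).a₂ * X ^ 2 +
        C (W.baseChange (AlgebraicClosure K)).a₄ * X +
        C (W.baseChange (AlgebraicClosure K)).a₆) := by
  set P : W.geomPoints := .some γ c h with hPdef
  set u : W.geomFunctionField := W.genY - aeval W.genX L with hudef
  set N : (AlgebraicClosure K)[X] := L ^ 2 +
    (C (W.baseChange (AlgebraicClosure K)).a₁ * X + C (W.baseChange (AlgebraicClosure K)).a₃) * L -
    (X ^ 3 + C (W.baseChange (AlgebraicClosure K)).a₂ * X ^ 2 +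
      C (W.baseChange (AlgebraicClosure K)).a₄ * X + C (W.baseChange (AlgebraicClosure K)).a₆)
    with hNdef
  have hxne : W.genX - algebraMap (AlgebraicClosure K) W.geomFunctionField γ ≠ 0 := fun h0 ↦
    transcendental_genX W ((sub_eq_zero.1 h0) ▸ isAlgebraic_algebraMap γ)
  -- the conjugate and the norm
  have hN : u * (-W.genY -
      algebraMap _ W.geomFunctionField (W.baseChange (AlgebraicClosure K)).a₁ * W.genX -
      algebraMap _ W.geomFunctionField (W.baseChange (AlgebraicClosure K)).a₃ -
      aeval W.genX L) = aeval W.genX N :=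
    sub_aeval_mul_conj (W.baseChange (AlgebraicClosure K)) equation_gen L
  have hubar0 : -W.genY -
      algebraMap _ W.geomFunctionField (W.baseChange (AlgebraicClosure K)).a₁ * W.genX -
      algebraMap _ W.geomFunctionField (W.baseChange (AlgebraicClosure K)).a₃ -
      aeval W.genX L ≠ 0 := by
    rw [← pullbackHom_neg_sub_aeval]
    exact (_root_.map_ne_zero _).2 hu
  have hNx0 : aeval W.genX N ≠ 0 := by rw [← hN]; exact mul_ne_zero hu hubar0
  have hN0 : N ≠ 0 := by rintro h0; rw [h0, map_zero] at hNx0; exact hNx0 rfl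
  have hordN : W.ordAt P (aeval W.genX N) = n + W.ordAt P (-W.genY -
      algebraMap _ W.geomFunctionField (W.baseChange (AlgebraicClosure K)).a₁ * W.genX -
      algebraMap _ W.geomFunctionField (W.baseChange (AlgebraicClosure K)).a₃ -
      aeval W.genX L) := by
    rw [← hN, ordAt_mul P hu hubar0, hn]
  -- `mult_γ(N) · v_P(x - γ) = v_P(N(x))`
  have hpos :
      0 < (W.place P).ord (W.genX - algebraMap (AlgebraicClosure K) W.geomFunctionField γ) := by
    rw [← ordAt_eq_ord_place P hxne]; exact ordAt_genX_sub_pos h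
  obtain ⟨-, hmult⟩ := (W.place P).ord_aeval_of_ord_sub_pos hpos hN0
  rw [← ordAt_eq_ord_place P hNx0, ← ordAt_eq_ord_place P hxne, hordN] at hmult
  have hx12 := ordAt_genX_sub_cases (W := W) h
  -- in both cases `mult = n`
  have hle : n ≤ (N.comp (X + C γ)).rootMultiplicity 0 := by
    by_cases h2t : (W.baseChange (AlgebraicClosure K)).toAffine.negY γ c = c
    · -- `R` of order `2`: `-R = R`, `v_R(x - γ) = 2`, `v_R(N(x)) = 2n`
      have hx2 : W.ordAt P (W.genX - algebraMap _ W.geomFunctionField γ) = 2 :=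
        (ordAt_genX_sub_eq_two_iff (W := W) h).2 h2t
      have heq : -P = P := by
        change -(Affine.Point.some γ c h : W.geomPoints) = (Affine.Point.some γ c h)
        rw [geomPoints.neg_some]
        congr 1
      have hconj : W.ordAt P (-W.genY -
          algebraMap _ W.geomFunctionField (W.baseChange (AlgebraicClosure K)).a₁ * W.genX -
          algebraMap _ W.geomFunctionField (W.baseChange (AlgebraicClosure K)).a₃ -
          aeval W.genX L) = n := by
        rw [ordAt_conj, heq]; exact hn
      rw [hconj, hx2] at hmult
      have : (n : ℤ) = (N.comp (X + C γ)).rootMultiplicity 0 := by omega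
      exact_mod_cast this.le
    · -- `R` not of order `2`: `-R ≠ R`, so `v_{-R}(u) = 0`, and `v_R(x - γ) = 1`
      have hne : -P ≠ P := by
        intro heq
        apply h2t
        change -(Affine.Point.some γ c h : W.geomPoints) = (Affine.Point.some γ c h) at heq
        rw [geomPoints.neg_some, Affine.Point.some.injEq] at heq
        exact heq.2
      have hx1 : W.ordAt P (W.genX - algebraMap _ W.geomFunctionField γ) = 1 := by
        rcases hx12 with h1 | ⟨h2, -⟩
        · exact h1
        · exact absurd ((ordAt_genX_sub_eq_two_iff (W := W) h).1 h2) h2t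
      have hconj : W.ordAt P (-W.genY -
          algebraMap _ W.geomFunctionField (W.baseChange (AlgebraicClosure K)).a₁ * W.genX -
          algebraMap _ W.geomFunctionField (W.baseChange (AlgebraicClosure K)).a₃ -
          aeval W.genX L) = 0 := by
        rw [ordAt_conj]; exact hneg hne
      rw [hconj, hx1] at hmult
      have : (n : ℤ) = (N.comp (X + C γ)).rootMultiplicity 0 := by omega
      exact_mod_cast this.le
  have hq0 : N.comp (X + C γ) ≠ 0 := by
    intro h0
    rw [comp_eq_zero_iff] at h0
    rcases h0 with h0 | ⟨-, h0⟩
    · exact hN0 h0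
    · have := congr_arg (fun q : (AlgebraicClosure K)[X] ↦ q.coeff 1) h0
      simp at this
  have hdvd : X ^ n ∣ N.comp (X + C γ) := by
    have := (le_rootMultiplicity_iff hq0).1 hle
    rwa [map_zero, sub_zero] at this
  -- compose back with `X - γ`
  obtain ⟨w, hw⟩ := hdvd
  have hback : N = (N.comp (X + C γ)).comp (X - C γ) := by
    rw [comp_assoc]; simp
  refine ⟨w.comp (X - C γ), ?_⟩
  rw [hback, hw, mul_comp, X_pow_comp]

/-- **Multiplicities of the norm at a zero whose negative is another zero**: if `v_R(u) = n`,
`-R ≠ R` and `v_{-R}(u) = m`, then `(X - γ)^{n+m} ∣ N_L` (`v_R(x - γ) = 1`,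
`v_R(N_L(x)) = n + m`). [cite: SilvermanAEC2009, Prop. II.2.6(a)] -/
theorem X_sub_C_pow_dvd_norm' {L : (AlgebraicClosure K)[X]} {γ c : AlgebraicClosure K}
    (h : (W.baseChange (AlgebraicClosure K)).toAffine.Nonsingular γ c) {n m : ℕ}
    (hu : W.genY - aeval W.genX L ≠ 0)
    (hn : W.ordAt (.some γ c h) (W.genY - aeval W.genX L) = n)
    (hne : -(Affine.Point.some γ c h : W.geomPoints) ≠ .some γ c h)
    (hm : W.ordAt (-(Affine.Point.some γ c h : W.geomPoints)) (W.genY - aeval W.genX L) = m) :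
    (X - C γ) ^ (n + m) ∣ L ^ 2 + (C (W.baseChange (AlgebraicClosure K)).a₁ * X +
      C (W.baseChange (AlgebraicClosure K)).a₃) * L -
      (X ^ 3 + C (W.baseChange (AlgebraicClosure K)).a₂ * X ^ 2 +
        C (W.baseChange (AlgebraicClosure K)).a₄ * X +
        C (W.baseChange (AlgebraicClosure K)).a₆) := by
  set P : W.geomPoints := .some γ c h with hPdef
  set u : W.geomFunctionField := W.genY - aeval W.genX L with hudef
  set N : (AlgebraicClosure K)[X] := L ^ 2 +
    (C (W.baseChange (AlgebraicClosure K)).a₁ * X + C (W.baseChange (AlgebraicClosure K)).a₃) * L -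
    (X ^ 3 + C (W.baseChange (AlgebraicClosure K)).a₂ * X ^ 2 +
      C (W.baseChange (AlgebraicClosure K)).a₄ * X + C (W.baseChange (AlgebraicClosure K)).a₆)
    with hNdef
  have hxne : W.genX - algebraMap (AlgebraicClosure K) W.geomFunctionField γ ≠ 0 := fun h0 ↦
    transcendental_genX W ((sub_eq_zero.1 h0) ▸ isAlgebraic_algebraMap γ)
  have hN : u * (-W.genY -
      algebraMap _ W.geomFunctionField (W.baseChange (AlgebraicClosure K)).a₁ * W.genX -
      algebraMap _ W.geomFunctionField (W.baseChange (AlgebraicClosure K)).a₃ -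
      aeval W.genX L) = aeval W.genX N :=
    sub_aeval_mul_conj (W.baseChange (AlgebraicClosure K)) equation_gen L
  have hubar0 : -W.genY -
      algebraMap _ W.geomFunctionField (W.baseChange (AlgebraicClosure K)).a₁ * W.genX -
      algebraMap _ W.geomFunctionField (W.baseChange (AlgebraicClosure K)).a₃ -
      aeval W.genX L ≠ 0 := by
    rw [← pullbackHom_neg_sub_aeval]
    exact (_root_.map_ne_zero _).2 hu
  have hNx0 : aeval W.genX N ≠ 0 := by rw [← hN]; exact mul_ne_zero hu hubar0
  have hN0 : N ≠ 0 := by rintro h0; rw [h0, map_zero] at hNx0; exact hNx0 rfl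
  have hconj : W.ordAt P (-W.genY -
      algebraMap _ W.geomFunctionField (W.baseChange (AlgebraicClosure K)).a₁ * W.genX -
      algebraMap _ W.geomFunctionField (W.baseChange (AlgebraicClosure K)).a₃ -
      aeval W.genX L) = m := by
    rw [ordAt_conj]; exact hm
  have hordN : W.ordAt P (aeval W.genX N) = n + m := by
    rw [← hN, ordAt_mul P hu hubar0, hn, hconj]
  -- `R` is not of order `2`, so `v_R(x - γ) = 1`
  have h2t : (W.baseChange (AlgebraicClosure K)).toAffine.negY γ c ≠ c := by
    intro h2
    apply hne
    change -(Affine.Point.some γ c h : W.geomPoints) = (Affine.Point.some γ c h)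
    rw [geomPoints.neg_some]
    congr 1
  have hx1 : W.ordAt P (W.genX - algebraMap _ W.geomFunctionField γ) = 1 := by
    rcases ordAt_genX_sub_cases (W := W) h with h1 | ⟨h2, -⟩
    · exact h1
    · exact absurd ((ordAt_genX_sub_eq_two_iff (W := W) h).1 h2) h2t
  have hpos :
      0 < (W.place P).ord (W.genX - algebraMap (AlgebraicClosure K) W.geomFunctionField γ) := by
    rw [← ordAt_eq_ord_place P hxne, hx1]; exact one_pos
  obtain ⟨-, hmult⟩ := (W.place P).ord_aeval_of_ord_sub_pos hpos hN0
  rw [← ordAt_eq_ord_place P hNx0, ← ordAt_eq_ord_place P hxne, hordN, hx1, mul_one] at hmult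
  have hle : n + m ≤ (N.comp (X + C γ)).rootMultiplicity 0 := by exact_mod_cast hmult.le
  have hq0 : N.comp (X + C γ) ≠ 0 := by
    intro h0
    rw [comp_eq_zero_iff] at h0
    rcases h0 with h0 | ⟨-, h0⟩
    · exact hN0 h0
    · have := congr_arg (fun q : (AlgebraicClosure K)[X] ↦ q.coeff 1) h0
      simp at this
  have hdvd : X ^ (n + m) ∣ N.comp (X + C γ) := by
    have := (le_rootMultiplicity_iff hq0).1 hle
    rwa [map_zero, sub_zero] at this
  obtain ⟨w, hw⟩ := hdvd
  have hback : N = (N.comp (X + C γ)).comp (X - C γ) := by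
    rw [comp_assoc]; simp
  refine ⟨w.comp (X - C γ), ?_⟩
  rw [hback, hw, mul_comp, X_pow_comp]

/-- The norm polynomial of `u = y - L(x)` for a quadratic `L = l₂X² + l₁X + l₀`, expanded.
[folklore] -/
theorem norm_expand {k : Type*} [CommRing k] (V : WeierstrassCurve k) (l₂ l₁ l₀ : k) :
    (C l₂ * X ^ 2 + C l₁ * X + C l₀) ^ 2 +
        (C V.a₁ * X + C V.a₃) * (C l₂ * X ^ 2 + C l₁ * X + C l₀) -
        (X ^ 3 + C V.a₂ * X ^ 2 + C V.a₄ * X + C V.a₆) =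
      C (l₂ ^ 2) * X ^ 4 + C (2 * l₂ * l₁ + V.a₁ * l₂ - 1) * X ^ 3 +
        C (l₁ ^ 2 + 2 * l₂ * l₀ + V.a₁ * l₁ + V.a₃ * l₂ - V.a₂) * X ^ 2 +
        C (2 * l₁ * l₀ + V.a₁ * l₀ + V.a₃ * l₁ - V.a₄) * X +
        C (l₀ ^ 2 + V.a₃ * l₀ - V.a₆) := by
  simp only [map_add, map_sub, map_mul, map_pow, map_ofNat, map_one]
  ring

/-- A quartic with leading coefficient `a` divisible by a monic quartic `q` is `a · q`.
[folklore] -/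
theorem quartic_eq_C_mul_of_dvd {k : Type*} [Field k] {a c₃ c₂ c₁ c₀ : k} {q : k[X]}
    (hq : q.Monic) (hqd : q.natDegree = 4)
    (hdvd : q ∣ C a * X ^ 4 + C c₃ * X ^ 3 + C c₂ * X ^ 2 + C c₁ * X + C c₀) :
    C a * X ^ 4 + C c₃ * X ^ 3 + C c₂ * X ^ 2 + C c₁ * X + C c₀ = C a * q := by
  -- the difference has degree `≤ 3` and is divisible by `q`
  have hq4 : q = X ^ 4 + C (q.coeff 3) * X ^ 3 + C (q.coeff 2) * X ^ 2 + C (q.coeff 1) * X +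
      C (q.coeff 0) := by
    conv_lhs => rw [q.as_sum_range_C_mul_X_pow, hqd]
    simp only [Finset.sum_range_succ, Finset.sum_range_zero, zero_add, pow_zero, mul_one, pow_one]
    rw [show q.coeff 4 = 1 by rw [← hqd]; exact hq]
    simp only [map_one, one_mul]
    ring
  have hdiff : q ∣ C a * X ^ 4 + C c₃ * X ^ 3 + C c₂ * X ^ 2 + C c₁ * X + C c₀ - C a * q :=
    dvd_sub hdvd (dvd_mul_left q _)
  have hdeg : (C a * X ^ 4 + C c₃ * X ^ 3 + C c₂ * X ^ 2 + C c₁ * X + C c₀ - C a * q).natDegree <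
      q.natDegree := by
    rw [hqd]
    have heq : C a * X ^ 4 + C c₃ * X ^ 3 + C c₂ * X ^ 2 + C c₁ * X + C c₀ - C a * q =
        C (c₃ - a * q.coeff 3) * X ^ 3 + C (c₂ - a * q.coeff 2) * X ^ 2 +
          C (c₁ - a * q.coeff 1) * X + C (c₀ - a * q.coeff 0) := by
      conv_lhs => rw [hq4]
      simp only [map_sub, map_mul]
      ring
    rw [heq]
    exact lt_of_le_of_lt natDegree_cubic_le (by norm_num)
  have h0 := eq_zero_of_dvd_of_natDegree_lt hdiff hdeg
  exact sub_eq_zero.1 h0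

/-! ### §2c Polynomial bookkeeping -/

/-- Coefficients of equal quartics with the same leading term. [folklore] -/
theorem coeffs_of_quartic_eq {k : Type*} [CommRing k] {a b₃ b₂ b₁ b₀ c₃ c₂ c₁ c₀ : k}
    (h : C a * X ^ 4 + C b₃ * X ^ 3 + C b₂ * X ^ 2 + C b₁ * X + C b₀ =
      C a * X ^ 4 + C c₃ * X ^ 3 + C c₂ * X ^ 2 + C c₁ * X + C c₀) :
    b₃ = c₃ ∧ b₂ = c₂ ∧ b₁ = c₁ ∧ b₀ = c₀ := by
  have h3 := congr_arg (fun p : k[X] ↦ p.coeff 3) h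
  have h2 := congr_arg (fun p : k[X] ↦ p.coeff 2) h
  have h1 := congr_arg (fun p : k[X] ↦ p.coeff 1) h
  have h0 := congr_arg (fun p : k[X] ↦ p.coeff 0) h
  simp only [coeff_add, coeff_C_mul, coeff_X_pow, coeff_X, coeff_C] at h3 h2 h1 h0
  norm_num at h3 h2 h1 h0
  exact ⟨h3, h2, h1, h0⟩

/-- `(X - α)(X - β)³`, recentred at `e` and expanded. [folklore] -/
theorem pattern13_comp {k : Type*} [CommRing k] (a α β e : k) :
    (C a * ((X - C α) * (X - C β) ^ 3)).comp (X + C e) =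
      C a * X ^ 4 + C (-(a * ((α - e) + 3 * (β - e)))) * X ^ 3 +
        C (a * (3 * (α - e) * (β - e) + 3 * (β - e) ^ 2)) * X ^ 2 +
        C (-(a * (3 * (α - e) * (β - e) ^ 2 + (β - e) ^ 3))) * X +
        C (a * ((α - e) * (β - e) ^ 3)) := by
  simp only [mul_comp, pow_comp, sub_comp, X_comp, C_comp, map_add, map_sub, map_mul, map_neg,
    map_pow, map_ofNat]
  ring

/-- `(X - α)²(X - β)²`, recentred at `e` and expanded. [folklore] -/
theorem pattern22_comp {k : Type*} [CommRing k] (a α β e : k) :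
    (C a * ((X - C α) ^ 2 * (X - C β) ^ 2)).comp (X + C e) =
      C a * X ^ 4 + C (-(a * (2 * (α - e) + 2 * (β - e)))) * X ^ 3 +
        C (a * ((α - e) ^ 2 + 4 * (α - e) * (β - e) + (β - e) ^ 2)) * X ^ 2 +
        C (-(a * (2 * (α - e) * (β - e) ^ 2 + 2 * (α - e) ^ 2 * (β - e)))) * X +
        C (a * ((α - e) ^ 2 * (β - e) ^ 2)) := by
  simp only [mul_comp, pow_comp, sub_comp, X_comp, C_comp, map_add, map_sub, map_mul, map_neg,
    map_pow, map_ofNat]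
  ring

/-- `(X - α)⁴`, recentred at `e` and expanded. [folklore] -/
theorem pattern4_comp {k : Type*} [CommRing k] (a α e : k) :
    (C a * (X - C α) ^ 4).comp (X + C e) =
      C a * X ^ 4 + C (-(a * (4 * (α - e)))) * X ^ 3 + C (a * (6 * (α - e) ^ 2)) * X ^ 2 +
        C (-(a * (4 * (α - e) ^ 3))) * X + C (a * (α - e) ^ 4) := by
  simp only [mul_comp, pow_comp, sub_comp, X_comp, C_comp, map_sub, map_mul, map_neg, map_pow,
    map_ofNat]
  ring

/-! ### §3a The case `c ≠ 0`: `6561 c₄³ = 207646 Δ` -/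

/-- **The case `c ≠ 0` of a degree-`4` Belyi function `a + bx + cy + dx²`**, in terms of
`u = f/c = y - L(x)` (`L = l₂X² + l₁X + l₀`, `l₂ ≠ 0`) and `u₁ = (f - 1)/c = y - (L + t)(x)`
(`t = 1/c ≠ 0`): if `u` has divisor `4P₀ - 4O` with `P₀ = (e₀, b₀)` and the affine zeros of `u₁`
are two points `R₁ = (α, c₁) ≠ R₂ = (β, c₂)` with multiplicities `n₁ + n₂ = 4`, then
`6561 c₄³ = 207646 Δ`, i.e. `j = 207646/6561`. [cite: Zapponi2009BelyiDegree, Example 1.2] -/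
theorem c₄_cube_eq_of_quad {l₂ l₁ l₀ t e₀ b₀ α c₁ β c₂ : AlgebraicClosure K} (hl : l₂ ≠ 0)
    (ht : t ≠ 0) (h₀ : (W.baseChange (AlgebraicClosure K)).toAffine.Nonsingular e₀ b₀)
    (h₁ : (W.baseChange (AlgebraicClosure K)).toAffine.Nonsingular α c₁)
    (h₂ : (W.baseChange (AlgebraicClosure K)).toAffine.Nonsingular β c₂)
    (hu0 : W.ordAt 0 (W.genY - aeval W.genX (C l₂ * X ^ 2 + C l₁ * X + C l₀)) = -4)
    (huP : W.ordAt (.some e₀ b₀ h₀) (W.genY - aeval W.genX (C l₂ * X ^ 2 + C l₁ * X + C l₀)) = 4)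
    (huR : ∀ R : W.geomPoints, R ≠ 0 → R ≠ .some e₀ b₀ h₀ →
      W.ordAt R (W.genY - aeval W.genX (C l₂ * X ^ 2 + C l₁ * X + C l₀)) = 0)
    (hne : (Affine.Point.some α c₁ h₁ : W.geomPoints) ≠ .some β c₂ h₂) {n₁ n₂ : ℕ}
    (hn₁ : 1 ≤ n₁) (hn₂ : 1 ≤ n₂) (hsum : n₁ + n₂ = 4)
    (hv₁ : W.ordAt (.some α c₁ h₁)
      (W.genY - aeval W.genX (C l₂ * X ^ 2 + C l₁ * X + C (l₀ + t))) = n₁)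
    (hv₂ : W.ordAt (.some β c₂ h₂)
      (W.genY - aeval W.genX (C l₂ * X ^ 2 + C l₁ * X + C (l₀ + t))) = n₂)
    (hvR : ∀ R : W.geomPoints, R ≠ 0 → R ≠ .some α c₁ h₁ → R ≠ .some β c₂ h₂ →
      W.ordAt R (W.genY - aeval W.genX (C l₂ * X ^ 2 + C l₁ * X + C (l₀ + t))) = 0) :
    6561 * (W.baseChange (AlgebraicClosure K)).c₄ ^ 3 =
      207646 * (W.baseChange (AlgebraicClosure K)).Δ := by
  set L₁ : (AlgebraicClosure K)[X] := C l₂ * X ^ 2 + C l₁ * X + C (l₀ + t) with hL₁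
  set u₁ : W.geomFunctionField := W.genY - aeval W.genX L₁ with hu₁def
  set R₁ : W.geomPoints := .some α c₁ h₁ with hR₁
  set R₂ : W.geomPoints := .some β c₂ h₂ with hR₂
  set N₁ : (AlgebraicClosure K)[X] := L₁ ^ 2 +
    (C (W.baseChange (AlgebraicClosure K)).a₁ * X + C (W.baseChange (AlgebraicClosure K)).a₃) * L₁ -
    (X ^ 3 + C (W.baseChange (AlgebraicClosure K)).a₂ * X ^ 2 +
      C (W.baseChange (AlgebraicClosure K)).a₄ * X + C (W.baseChange (AlgebraicClosure K)).a₆)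
    with hN₁def
  -- the zero fibre
  obtain ⟨-, -, H3, H2, H1, H0⟩ := zero_fibre_coeffs (W := W) h₀ hu0 huP huR
  have hu₁ne : u₁ ≠ 0 := by
    intro h0; rw [h0, ordAt_zero_right] at hv₁; omega
  -- the norm `N₁`, expanded and recentred at `e₀`
  have hexp : N₁.comp (X + C e₀) = C (l₂ ^ 2) * X ^ 4 +
      C (2 * l₂ * (l₁ + 2 * l₂ * e₀) + (W.baseChange (AlgebraicClosure K)).a₁ * l₂ - 1) * X ^ 3 +
      C ((l₁ + 2 * l₂ * e₀) ^ 2 + 2 * l₂ * (l₂ * e₀ ^ 2 + l₁ * e₀ + (l₀ + t)) +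
        (W.baseChange (AlgebraicClosure K)).a₁ * (l₁ + 2 * l₂ * e₀) +
        ((W.baseChange (AlgebraicClosure K)).a₃ + e₀ * (W.baseChange (AlgebraicClosure K)).a₁) *
          l₂ - ((W.baseChange (AlgebraicClosure K)).a₂ + 3 * e₀)) * X ^ 2 +
      C (2 * (l₁ + 2 * l₂ * e₀) * (l₂ * e₀ ^ 2 + l₁ * e₀ + (l₀ + t)) +
        (W.baseChange (AlgebraicClosure K)).a₁ * (l₂ * e₀ ^ 2 + l₁ * e₀ + (l₀ + t)) +
        ((W.baseChange (AlgebraicClosure K)).a₃ + e₀ * (W.baseChange (AlgebraicClosure K)).a₁) *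
          (l₁ + 2 * l₂ * e₀) -
        ((W.baseChange (AlgebraicClosure K)).a₄ + 2 * e₀ * (W.baseChange (AlgebraicClosure K)).a₂ +
          3 * e₀ ^ 2)) * X +
      C ((l₂ * e₀ ^ 2 + l₁ * e₀ + (l₀ + t)) ^ 2 +
        ((W.baseChange (AlgebraicClosure K)).a₃ + e₀ * (W.baseChange (AlgebraicClosure K)).a₁) *
          (l₂ * e₀ ^ 2 + l₁ * e₀ + (l₀ + t)) -
        ((W.baseChange (AlgebraicClosure K)).a₆ + e₀ * (W.baseChange (AlgebraicClosure K)).a₄ +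
          e₀ ^ 2 * (W.baseChange (AlgebraicClosure K)).a₂ + e₀ ^ 3)) :=
    norm_comp_X_add_C _ l₂ l₁ (l₀ + t) e₀
  have hN₁exp := norm_expand (W.baseChange (AlgebraicClosure K)) l₂ l₁ (l₀ + t)
  by_cases hαβ : α = β
  · -- the two zeros are opposite: `R₂ = -R₁`, `(X - α)⁴ ∣ N₁`
    subst hαβ
    have hc₂ : c₂ = (W.baseChange (AlgebraicClosure K)).toAffine.negY α c₁ := by
      rcases Affine.Y_eq_of_X_eq h₂.1 h₁.1 rfl with h | h
      · exact absurd (by subst h; rfl) hne.symm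
      · exact h
    have hneg : -R₁ = R₂ := by
      change -(Affine.Point.some α c₁ h₁ : W.geomPoints) = (Affine.Point.some α c₂ h₂)
      rw [geomPoints.neg_some]
      congr 1
      exact hc₂.symm
    have hdvd := X_sub_C_pow_dvd_norm' (W := W) h₁ hu₁ne hv₁ (fun h ↦ hne (h.symm.trans hneg))
      (hneg ▸ hv₂)
    rw [hsum, ← hN₁def] at hdvd
    have hq : ((X - C α) ^ 4 : (AlgebraicClosure K)[X]).Monic := (monic_X_sub_C α).pow 4
    have hqd : ((X - C α) ^ 4 : (AlgebraicClosure K)[X]).natDegree = 4 := by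
      rw [(monic_X_sub_C α).natDegree_pow, natDegree_X_sub_C, mul_one]
    rw [hN₁def, hL₁, hN₁exp] at hdvd
    have heq := quartic_eq_C_mul_of_dvd hq hqd hdvd
    have heq' := congr_arg (fun p : (AlgebraicClosure K)[X] ↦ p.comp (X + C e₀)) heq
    rw [← hN₁exp, ← hL₁, ← hN₁def, hexp, pattern4_comp] at heq'
    obtain ⟨E3, E2, -, -⟩ := coeffs_of_quartic_eq heq'
    exact (false_of_pattern4 (α := α - e₀) hl ht (by linear_combination E3 - H3)
      (by linear_combination E2 - H2)).elim
  · -- two zeros with different `x`-coordinates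
    have hx_ne : ∀ {y₁ y₂ : AlgebraicClosure K}
        (g₁ : (W.baseChange (AlgebraicClosure K)).toAffine.Nonsingular α y₁)
        (g₂ : (W.baseChange (AlgebraicClosure K)).toAffine.Nonsingular β y₂),
        (Affine.Point.some α y₁ g₁ : W.geomPoints) ≠ .some β y₂ g₂ := by
      intro y₁ y₂ g₁ g₂ heq
      rw [Affine.Point.some.injEq] at heq
      exact hαβ heq.1
    have hdvd₁ := X_sub_C_pow_dvd_norm (W := W) h₁ hu₁ne hv₁ (fun hn1 ↦ by
      have h' : -(Affine.Point.some α c₁ h₁ : W.geomPoints) =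
          Affine.Point.some α _ ((Affine.nonsingular_neg ..).mpr h₁) := geomPoints.neg_some h₁
      rw [h']
      refine hvR _ (Affine.Point.some_ne_zero _) ?_ (hx_ne _ _)
      rw [← h']; exact hn1)
    have hdvd₂ := X_sub_C_pow_dvd_norm (W := W) h₂ hu₁ne hv₂ (fun hn2 ↦ by
      have h' : -(Affine.Point.some β c₂ h₂ : W.geomPoints) =
          Affine.Point.some β _ ((Affine.nonsingular_neg ..).mpr h₂) := geomPoints.neg_some h₂
      rw [h']
      refine hvR _ (Affine.Point.some_ne_zero _) (fun h ↦ hx_ne _ _ h.symm) ?_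
      rw [← h']; exact hn2)
    rw [← hN₁def] at hdvd₁ hdvd₂
    have hcop : IsCoprime ((X - C α) ^ n₁) ((X - C β) ^ n₂ : (AlgebraicClosure K)[X]) :=
      (isCoprime_X_sub_C_of_isUnit_sub (sub_ne_zero.2 hαβ).isUnit).pow
    have hdvd := hcop.mul_dvd hdvd₁ hdvd₂
    have hq : ((X - C α) ^ n₁ * (X - C β) ^ n₂ : (AlgebraicClosure K)[X]).Monic :=
      ((monic_X_sub_C α).pow n₁).mul ((monic_X_sub_C β).pow n₂)
    have hqd : ((X - C α) ^ n₁ * (X - C β) ^ n₂ : (AlgebraicClosure K)[X]).natDegree = 4 := by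
      rw [((monic_X_sub_C α).pow n₁).natDegree_mul ((monic_X_sub_C β).pow n₂),
        (monic_X_sub_C α).natDegree_pow, (monic_X_sub_C β).natDegree_pow, natDegree_X_sub_C,
        natDegree_X_sub_C, mul_one, mul_one, hsum]
    rw [hN₁def, hL₁, hN₁exp] at hdvd
    have heq := quartic_eq_C_mul_of_dvd hq hqd hdvd
    have heq' := congr_arg (fun p : (AlgebraicClosure K)[X] ↦ p.comp (X + C e₀)) heq
    rw [← hN₁exp, ← hL₁, ← hN₁def, hexp] at heq'
    -- the three patterns
    have hn₁3 : n₁ = 1 ∨ n₁ = 2 ∨ n₁ = 3 := by omega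
    rcases hn₁3 with rfl | rfl | rfl
    · have hn₂3 : n₂ = 3 := by omega
      subst hn₂3
      rw [pow_one, pattern13_comp] at heq'
      obtain ⟨E3, E2, E1, E0⟩ := coeffs_of_quartic_eq heq'
      exact c₄_cube_eq_of_pattern13 _ (α := α - e₀) (β := β - e₀) hl ht H3 H2 H1 H0
        (by linear_combination E3 - H3) (by linear_combination E2 - H2)
        (by linear_combination E1 - H1) (by linear_combination E0 - H0)
    · have hn₂2 : n₂ = 2 := by omega
      subst hn₂2
      rw [pattern22_comp] at heq'
      obtain ⟨E3, -, E1, -⟩ := coeffs_of_quartic_eq heq'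
      exact (false_of_pattern22 _ (α := α - e₀) (β := β - e₀) hl ht H3
        (by linear_combination E3 - H3) (by linear_combination E1 - H1)).elim
    · have hn₂1 : n₂ = 1 := by omega
      subst hn₂1
      rw [pow_one, mul_comm ((X - C α) ^ 3) (X - C β), pattern13_comp] at heq'
      obtain ⟨E3, E2, E1, E0⟩ := coeffs_of_quartic_eq heq'
      exact c₄_cube_eq_of_pattern13 _ (α := β - e₀) (β := α - e₀) hl ht H3 H2 H1 H0
        (by linear_combination E3 - H3) (by linear_combination E2 - H2)
        (by linear_combination E1 - H1) (by linear_combination E0 - H0)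

/-! ### §3b The case `c = 0`: `j = 1728` -/

/-- Every `x`-coordinate carries an affine point of `E(K̄)`. [folklore] -/
theorem exists_point_over (r : AlgebraicClosure K) :
    ∃ y : AlgebraicClosure K, (W.baseChange (AlgebraicClosure K)).toAffine.Nonsingular r y := by
  haveI : (W.baseChange (AlgebraicClosure K)).IsElliptic := by
    rw [WeierstrassCurve.baseChange]; infer_instance
  obtain ⟨y, hy⟩ := IsAlgClosed.exists_root
    (C 1 * X ^ 2 +
      C ((W.baseChange (AlgebraicClosure K)).a₁ * r + (W.baseChange (AlgebraicClosure K)).a₃) * X +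
      C (-(r ^ 3 + (W.baseChange (AlgebraicClosure K)).a₂ * r ^ 2 +
        (W.baseChange (AlgebraicClosure K)).a₄ * r + (W.baseChange (AlgebraicClosure K)).a₆)))
    (by rw [degree_quadratic one_ne_zero]; norm_num)
  refine ⟨y, (Affine.equation_iff_nonsingular).1 ?_⟩
  rw [Affine.equation_iff]
  simp only [IsRoot.def, eval_add, eval_mul, eval_pow, eval_X, eval_C, one_mul] at hy
  linear_combination hy

omit [CharZero K] in
/-- A product `d (x - r₁)(x - r₂)` vanishes at every affine point over `r₁`. [folklore] -/
theorem ordAt_prod_pos {d r₁ r₂ γ y : AlgebraicClosure K} (hd : d ≠ 0)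
    (h : (W.baseChange (AlgebraicClosure K)).toAffine.Nonsingular γ y) (hγ : γ = r₁ ∨ γ = r₂) :
    0 < W.ordAt (.some γ y h) (algebraMap _ W.geomFunctionField d *
      (W.genX - algebraMap _ W.geomFunctionField r₁) *
      (W.genX - algebraMap _ W.geomFunctionField r₂)) := by
  have hx : ∀ c : AlgebraicClosure K, W.genX - algebraMap _ W.geomFunctionField c ≠ 0 :=
    fun c h0 ↦ transcendental_genX W ((sub_eq_zero.1 h0) ▸ isAlgebraic_algebraMap c)
  have hP0 : (Affine.Point.some γ y h : W.geomPoints) ≠ 0 := Affine.Point.some_ne_zero h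
  have hnn : ∀ c : AlgebraicClosure K,
      0 ≤ W.ordAt (.some γ y h) (W.genX - algebraMap _ W.geomFunctionField c) := fun c ↦ by
    rw [genX_sub_algebraMap]; exact ordAt_algebraMap_nonneg hP0 _
  rw [mul_assoc, ordAt_algebraMap_mul _ hd, ordAt_mul _ (hx r₁) (hx r₂)]
  rcases hγ with rfl | rfl
  · have := ordAt_genX_sub_pos (W := W) h
    have := hnn r₂
    omega
  · have := ordAt_genX_sub_pos (W := W) h
    have := hnn r₁
    omega

/-- **The case `c = 0` of a degree-`4` Belyi function**: if `f = a + bx + dx²` (`d ≠ 0`) has a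
single affine zero `P₀ = (e₀, b₀)` and the affine zeros of `f - 1` lie in a two-element set
`{R₁, R₂}`, then `f = d(x - r)²`, the points over `r` and `r ± δ` (`δ² = 1/d`) are their own
negatives, the `2`-division cubic vanishes at `r, r ± δ`, and `c₄³ = 1728 Δ` (`j = 1728`).
[cite: Zapponi2009BelyiDegree, Example 1.2] -/
theorem c₄_cube_eq_of_sq {a b d e₀ b₀ : AlgebraicClosure K} (hd : d ≠ 0)
    (h₀ : (W.baseChange (AlgebraicClosure K)).toAffine.Nonsingular e₀ b₀) (R₁ R₂ : W.geomPoints)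
    (hz : ∀ R : W.geomPoints, R ≠ 0 →
      0 < W.ordAt R (algebraMap _ W.geomFunctionField a +
        algebraMap _ W.geomFunctionField b * W.genX +
        algebraMap _ W.geomFunctionField d * W.genX ^ 2) → R = .some e₀ b₀ h₀)
    (ho : ∀ R : W.geomPoints, R ≠ 0 →
      0 < W.ordAt R (algebraMap _ W.geomFunctionField a +
        algebraMap _ W.geomFunctionField b * W.genX +
        algebraMap _ W.geomFunctionField d * W.genX ^ 2 - 1) → R = R₁ ∨ R = R₂) :
    (W.baseChange (AlgebraicClosure K)).c₄ ^ 3 = 1728 * (W.baseChange (AlgebraicClosure K)).Δ := by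
  set ι := algebraMap (AlgebraicClosure K) W.geomFunctionField with hι
  -- factor `f = d (x - r₁)(x - r₂)`
  obtain ⟨r₁, hr₁⟩ :=
    IsAlgClosed.exists_root (C d * X ^ 2 + C b * X + C a : (AlgebraicClosure K)[X])
      (by rw [degree_quadratic hd]; norm_num)
  simp only [IsRoot.def, eval_add, eval_mul, eval_pow, eval_X, eval_C] at hr₁
  set r₂ : AlgebraicClosure K := -(b / d) - r₁ with hr₂
  have hfac : ι a + ι b * W.genX + ι d * W.genX ^ 2 =
      ι d * (W.genX - ι r₁) * (W.genX - ι r₂) := by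
    have ha : a = -d * r₁ ^ 2 - b * r₁ := by linear_combination hr₁
    have hdF : ι d ≠ 0 := (_root_.map_ne_zero ι).2 hd
    rw [ha, hr₂]
    simp only [map_mul, map_neg, map_sub, map_div₀, map_pow]
    field_simp
    ring
  -- both `x`-values carry the zero `P₀`: `r₁ = e₀ = r₂`
  have hroot : ∀ r : AlgebraicClosure K, (r = r₁ ∨ r = r₂) → r = e₀ := by
    intro r hr
    obtain ⟨y, hy⟩ := exists_point_over (W := W) r
    have hpos := ordAt_prod_pos (W := W) hd hy hr
    rw [← hfac] at hpos
    have := hz _ (Affine.Point.some_ne_zero hy) hpos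
    exact (Affine.Point.some.inj this).1
  have he₁ : r₁ = e₀ := hroot r₁ (Or.inl rfl)
  have he₂ : r₂ = e₀ := hroot r₂ (Or.inr rfl)
  -- `P₀` is its own negative
  have hneg₀ : (W.baseChange (AlgebraicClosure K)).toAffine.negY e₀ b₀ = b₀ := by
    have hy := (Affine.nonsingular_neg e₀ b₀).2 h₀
    have hpos := ordAt_prod_pos (W := W) (r₁ := r₁) (r₂ := r₂) hd hy (Or.inl he₁.symm)
    rw [← hfac] at hpos
    have := hz _ (Affine.Point.some_ne_zero hy) hpos
    exact (Affine.Point.some.inj this).2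
  -- `f - 1 = d (x - (e₀ + δ))(x - (e₀ - δ))`, `δ² = 1/d`
  obtain ⟨δ, hδ⟩ := IsAlgClosed.exists_pow_nat_eq (d⁻¹) (by norm_num : 0 < 2)
  have hδ0 : δ ≠ 0 := by rintro rfl; rw [zero_pow two_ne_zero] at hδ; exact inv_ne_zero hd hδ.symm
  have hfac1 : ι a + ι b * W.genX + ι d * W.genX ^ 2 - 1 =
      ι d * (W.genX - ι (e₀ + δ)) * (W.genX - ι (e₀ - δ)) := by
    rw [hfac, he₁, he₂]
    have h1 : (1 : W.geomFunctionField) = ι d * ι δ ^ 2 := by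
      rw [← map_pow, hδ, ← map_mul, mul_inv_cancel₀ hd, map_one]
    rw [h1]
    simp only [map_add, map_sub]
    ring
  -- the points over `e₀ ± δ` and their negatives are zeros of `f - 1`
  have hmem : ∀ {γ y : AlgebraicClosure K}
      (hy : (W.baseChange (AlgebraicClosure K)).toAffine.Nonsingular γ y),
      (γ = e₀ + δ ∨ γ = e₀ - δ) → (Affine.Point.some γ y hy : W.geomPoints) = R₁ ∨
        (Affine.Point.some γ y hy : W.geomPoints) = R₂ := by
    intro γ y hy hγ
    have hpos := ordAt_prod_pos (W := W) hd hy hγ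
    rw [← hfac1] at hpos
    exact ho _ (Affine.Point.some_ne_zero hy) hpos
  have hpm : e₀ + δ ≠ e₀ - δ := by
    intro h; apply hδ0; linear_combination h / 2
  -- each of `e₀ ± δ` carries a point of order `2`
  have hkey : ∀ {γ : AlgebraicClosure K}, (γ = e₀ + δ ∨ γ = e₀ - δ) →
      ∃ y, (W.baseChange (AlgebraicClosure K)).toAffine.Equation γ y ∧
        (W.baseChange (AlgebraicClosure K)).toAffine.negY γ y = y := by
    intro γ hγ
    obtain ⟨y, hy⟩ := exists_point_over (W := W) γ
    refine ⟨y, hy.1, ?_⟩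
    -- the other `x`-value
    set γ' : AlgebraicClosure K := if γ = e₀ + δ then e₀ - δ else e₀ + δ with hγ'
    have hγ'mem : γ' = e₀ + δ ∨ γ' = e₀ - δ := by
      rw [hγ']; split_ifs <;> simp
    have hγne : γ' ≠ γ := by
      rw [hγ']; split_ifs with hc
      · rw [hc]; exact hpm.symm
      · rcases hγ with hc' | hc'
        · exact absurd hc' hc
        · rw [hc']; exact hpm
    obtain ⟨y', hy'⟩ := exists_point_over (W := W) γ'
    have hyn := (Affine.nonsingular_neg γ y).2 hy
    -- `S, -S, S'` all lie in `{R₁, R₂}` and `x(S') ≠ x(S) = x(-S)`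
    have m1 := hmem hy hγ
    have m2 := hmem hyn hγ
    have m3 := hmem hy' hγ'mem
    have hSS' : ∀ {z z' : AlgebraicClosure K}
        (g : (W.baseChange (AlgebraicClosure K)).toAffine.Nonsingular γ z)
        (g' : (W.baseChange (AlgebraicClosure K)).toAffine.Nonsingular γ' z'),
        (Affine.Point.some γ z g : W.geomPoints) ≠ Affine.Point.some γ' z' g' := by
      intro z z' g g' heq
      exact hγne (Affine.Point.some.inj heq).1.symm
    have heqS : (Affine.Point.some γ _ hyn : W.geomPoints) = Affine.Point.some γ y hy := by
      rcases m1 with m1 | m1 <;> rcases m2 with m2 | m2 <;> rcases m3 with m3 | m3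
      · rw [m2, m1]
      · rw [m2, m1]
      · exact absurd (m1.trans m3.symm) (hSS' hy hy')
      · exact absurd (m2.trans m3.symm) (hSS' hyn hy')
      · exact absurd (m2.trans m3.symm) (hSS' hyn hy')
      · exact absurd (m1.trans m3.symm) (hSS' hy hy')
      · rw [m2, m1]
      · rw [m2, m1]
    exact (Affine.Point.some.inj heqS).2
  obtain ⟨yp, hyp, hnp⟩ := hkey (Or.inl rfl)
  obtain ⟨ym, hym, hnm⟩ := hkey (Or.inr rfl)
  exact c₄_cube_eq_of_three_roots _ hδ0 (two_division_cubic_eq_zero _ h₀.1 hneg₀)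
    (two_division_cubic_eq_zero _ hyp hnp) (two_division_cubic_eq_zero _ hym hnm)

/-! ### §3c From `f = a + bx + cy + dx²` to the two cases -/

omit [CharZero K] in
/-- `a + bx + cy + dx²` is a regular function: `ord_R ≥ 0` at affine points. [folklore] -/
theorem ordAt_quad_nonneg {R : W.geomPoints} (hR : R ≠ 0) (a b c d : AlgebraicClosure K) :
    0 ≤ W.ordAt R (algebraMap _ W.geomFunctionField a +
      algebraMap _ W.geomFunctionField b * W.genX + algebraMap _ W.geomFunctionField c * W.genY +
      algebraMap _ W.geomFunctionField d * W.genX ^ 2) := by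
  have h : algebraMap _ W.geomFunctionField a + algebraMap _ W.geomFunctionField b * W.genX +
      algebraMap _ W.geomFunctionField c * W.genY +
      algebraMap _ W.geomFunctionField d * W.genX ^ 2 =
      algebraMap (W.baseChange (AlgebraicClosure K)).toAffine.CoordinateRing W.geomFunctionField
        (Affine.CoordinateRing.mk _ (C (C a + C b * X + C d * X ^ 2) + C (C c) * Y)) := by
    rw [EllipticCurves.WeierstrassFunctionField.algebraMap_mk]
    simp only [map_add, map_mul, map_pow, aevalAeval_C, aevalAeval_Y, aeval_C, aeval_X]
    ring
  rw [h]; exact ordAt_algebraMap_nonneg hR _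

/-- **`f = a + bx + cy + dx²` with `c ≠ 0`**: the fibre data of a degree-`4` Belyi function (pole
`O` of order `4`, a single zero `P₀` of order `4`, zeros `R₁ ≠ R₂` of `f - 1` of orders
`n₁ + n₂ = 4`) give `6561 c₄³ = 207646 Δ`, through `u = f/c = y - L(x)` and
`c₄_cube_eq_of_quad`. [cite: Zapponi2009BelyiDegree, Example 1.2] -/
theorem c₄_cube_eq_of_quad_f {a b c d e₀ b₀ α c₁ β c₂ : AlgebraicClosure K} (hc : c ≠ 0)
    (hd : d ≠ 0) (h₀ : (W.baseChange (AlgebraicClosure K)).toAffine.Nonsingular e₀ b₀)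
    (h₁ : (W.baseChange (AlgebraicClosure K)).toAffine.Nonsingular α c₁)
    (h₂ : (W.baseChange (AlgebraicClosure K)).toAffine.Nonsingular β c₂)
    (hf0 : W.ordAt 0 (algebraMap _ W.geomFunctionField a +
      algebraMap _ W.geomFunctionField b * W.genX + algebraMap _ W.geomFunctionField c * W.genY +
      algebraMap _ W.geomFunctionField d * W.genX ^ 2) = -4)
    (hzP : W.ordAt (.some e₀ b₀ h₀) (algebraMap _ W.geomFunctionField a +
      algebraMap _ W.geomFunctionField b * W.genX + algebraMap _ W.geomFunctionField c * W.genY +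
      algebraMap _ W.geomFunctionField d * W.genX ^ 2) = 4)
    (hz : ∀ R : W.geomPoints, R ≠ 0 → 0 < W.ordAt R (algebraMap _ W.geomFunctionField a +
      algebraMap _ W.geomFunctionField b * W.genX + algebraMap _ W.geomFunctionField c * W.genY +
      algebraMap _ W.geomFunctionField d * W.genX ^ 2) → R = .some e₀ b₀ h₀)
    (hne : (Affine.Point.some α c₁ h₁ : W.geomPoints) ≠ .some β c₂ h₂) {n₁ n₂ : ℕ}
    (hn₁ : 1 ≤ n₁) (hn₂ : 1 ≤ n₂) (hsum : n₁ + n₂ = 4)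
    (hv₁ : W.ordAt (.some α c₁ h₁) (algebraMap _ W.geomFunctionField a +
      algebraMap _ W.geomFunctionField b * W.genX + algebraMap _ W.geomFunctionField c * W.genY +
      algebraMap _ W.geomFunctionField d * W.genX ^ 2 - 1) = n₁)
    (hv₂ : W.ordAt (.some β c₂ h₂) (algebraMap _ W.geomFunctionField a +
      algebraMap _ W.geomFunctionField b * W.genX + algebraMap _ W.geomFunctionField c * W.genY +
      algebraMap _ W.geomFunctionField d * W.genX ^ 2 - 1) = n₂)
    (ho : ∀ R : W.geomPoints, R ≠ 0 → 0 < W.ordAt R (algebraMap _ W.geomFunctionField a +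
      algebraMap _ W.geomFunctionField b * W.genX + algebraMap _ W.geomFunctionField c * W.genY +
      algebraMap _ W.geomFunctionField d * W.genX ^ 2 - 1) →
      R = .some α c₁ h₁ ∨ R = .some β c₂ h₂) :
    6561 * (W.baseChange (AlgebraicClosure K)).c₄ ^ 3 =
      207646 * (W.baseChange (AlgebraicClosure K)).Δ := by
  set f : W.geomFunctionField := algebraMap (AlgebraicClosure K) W.geomFunctionField a +
    algebraMap (AlgebraicClosure K) W.geomFunctionField b * W.genX +
    algebraMap (AlgebraicClosure K) W.geomFunctionField c * W.genY +
    algebraMap (AlgebraicClosure K) W.geomFunctionField d * W.genX ^ 2 with hfdef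
  have hcι : algebraMap (AlgebraicClosure K) W.geomFunctionField c ≠ 0 :=
    (_root_.map_ne_zero (algebraMap (AlgebraicClosure K) W.geomFunctionField)).2 hc
  -- `u = f/c = y - L(x)`, `u₁ = (f - 1)/c = y - (L + 1/c)(x)`
  have hu : W.genY - aeval W.genX (C (-d / c) * X ^ 2 + C (-b / c) * X + C (-a / c)) =
      algebraMap (AlgebraicClosure K) W.geomFunctionField c⁻¹ * f := by
    rw [hfdef]
    simp only [map_add, map_mul, map_pow, aeval_C, aeval_X, map_div₀, map_neg, map_inv₀]
    field_simp
    ring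
  have hu₁ : W.genY - aeval W.genX (C (-d / c) * X ^ 2 + C (-b / c) * X + C (-a / c + c⁻¹)) =
      algebraMap (AlgebraicClosure K) W.geomFunctionField c⁻¹ * (f - 1) := by
    rw [hfdef]
    simp only [map_add, map_mul, map_pow, aeval_C, aeval_X, map_div₀, map_neg, map_inv₀]
    field_simp
    ring
  have hordu : ∀ R : W.geomPoints,
      W.ordAt R (W.genY - aeval W.genX (C (-d / c) * X ^ 2 + C (-b / c) * X + C (-a / c))) =
        W.ordAt R f := fun R ↦ by
    rw [hu, ordAt_algebraMap_mul R (inv_ne_zero hc)]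
  have hordu₁ : ∀ R : W.geomPoints,
      W.ordAt R (W.genY - aeval W.genX (C (-d / c) * X ^ 2 + C (-b / c) * X + C (-a / c + c⁻¹))) =
        W.ordAt R (f - 1) := fun R ↦ by
    rw [hu₁, ordAt_algebraMap_mul R (inv_ne_zero hc)]
  have hreg : ∀ R : W.geomPoints, R ≠ 0 → 0 ≤ W.ordAt R f := fun R hR ↦ ordAt_quad_nonneg hR a b c d
  have hreg1 : ∀ R : W.geomPoints, R ≠ 0 → 0 ≤ W.ordAt R (f - 1) := fun R hR ↦ by
    have h := ordAt_quad_nonneg (W := W) hR (a - 1) b c d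
    have he : algebraMap (AlgebraicClosure K) W.geomFunctionField (a - 1) +
        algebraMap (AlgebraicClosure K) W.geomFunctionField b * W.genX +
        algebraMap (AlgebraicClosure K) W.geomFunctionField c * W.genY +
        algebraMap (AlgebraicClosure K) W.geomFunctionField d * W.genX ^ 2 = f - 1 := by
      rw [hfdef, map_sub, map_one]; ring
    rwa [he] at h
  refine c₄_cube_eq_of_quad (W := W) (l₁ := -b / c) (l₀ := -a / c) (t := c⁻¹)
    (div_ne_zero (neg_ne_zero.2 hd) hc) (inv_ne_zero hc) h₀ h₁ h₂ ?_ ?_ ?_ hne hn₁ hn₂ hsum ?_ ?_ ?_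
  · rw [hordu]; exact hf0
  · rw [hordu]; exact hzP
  · intro R hR0 hRP
    rw [hordu]
    have h1 := hreg R hR0
    have h2 : ¬ 0 < W.ordAt R f := fun hpos ↦ hRP (hz R hR0 hpos)
    omega
  · rw [hordu₁]; exact hv₁
  · rw [hordu₁]; exact hv₂
  · intro R hR0 hR1 hR2
    rw [hordu₁]
    have h1 := hreg1 R hR0
    have h2 : ¬ 0 < W.ordAt R (f - 1) := fun hpos ↦ by
      rcases ho R hR0 hpos with h | h
      · exact hR1 h
      · exact hR2 h
    omega

end FunctionField

/-! ### §3d The `S₃`-arrangement: singleton fibres over `∞` and `0` -/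

section Arrange

variable {K' : Type u} {F : Type u} [Field K'] [Field F] [Algebra K' F]

/-- At a pole of `f`, `f - c` has the same order; off the poles, `f - c` is integral. Hence
`v_P(f - c) < 0 ↔ v_P(f) < 0`. [folklore] -/
theorem ord_sub_algebraMap_neg_iff (P : PlaceOver K' F) {f : F} (hf : f ≠ 0) {c : K'}
    (hfc : f - algebraMap K' F c ≠ 0) : P.ord (f - algebraMap K' F c) < 0 ↔ P.ord f < 0 := by
  rcases eq_or_ne c 0 with rfl | hc
  · rw [map_zero, sub_zero]
  have hcF : algebraMap K' F c ≠ 0 := (_root_.map_ne_zero _).2 hc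
  constructor
  · intro h
    by_contra hge
    push Not at hge
    have hmem : f - algebraMap K' F c ∈ P.toValuationSubring :=
      sub_mem ((P.mem_toValuationSubring_iff_ord_nonneg hf).2 hge) (P.algebraMap_mem c)
    have := (P.mem_toValuationSubring_iff_ord_nonneg hfc).1 hmem
    omega
  · intro h
    have hlt : P.ord f < P.ord (-algebraMap K' F c) := by
      rw [PlaceOver.ord_neg, PlaceOver.ord_algebraMap_holds P hc]; exact h
    have h2 := P.ord_add_eq_left_of_lt hf (neg_ne_zero.2 hcF) hlt
    rw [← sub_eq_add_neg] at h2
    rw [h2.2]; exact h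

/-- **Fibres of `1 - 1/f`**: its poles are the zeros of `f`, its zeros are the zeros of `f - 1`
(`1 - 1/f = (f - 1)/f`). [folklore] -/
theorem ord_one_sub_inv (P : PlaceOver K' F) {f : F} (hf : f ≠ 0) (hf1 : f - 1 ≠ 0) :
    (P.ord (1 - f⁻¹) < 0 ↔ 0 < P.ord f) ∧ (0 < P.ord (1 - f⁻¹) ↔ 0 < P.ord (f - 1)) := by
  have hg : (1 : F) - f⁻¹ = (f - 1) * f⁻¹ := by field_simp
  have hord : P.ord (1 - f⁻¹) = P.ord (f - 1) - P.ord f := by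
    rw [hg, P.ord_mul_eq hf1 (inv_ne_zero hf), P.ord_inv hf]; ring
  have h1ord : P.ord (1 : F) = 0 := by
    rw [show (1 : F) = algebraMap K' F 1 from (map_one _).symm]
    exact PlaceOver.ord_algebraMap_holds P one_ne_zero
  -- `v(f - 1)` in terms of `v(f)`
  have hpos : 0 < P.ord f → P.ord (f - 1) = 0 := fun h ↦ by
    have hlt : P.ord (-1 : F) < P.ord f := by rw [PlaceOver.ord_neg, h1ord]; exact h
    have h2 := P.ord_add_eq_left_of_lt (neg_ne_zero.2 one_ne_zero) hf hlt
    rw [neg_add_eq_sub] at h2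
    rw [h2.2, PlaceOver.ord_neg, h1ord]
  have hneg : P.ord f < 0 → P.ord (f - 1) = P.ord f := fun h ↦ by
    have h1 : f - 1 = f - algebraMap K' F 1 := by rw [map_one]
    have hlt : P.ord f < P.ord (-algebraMap K' F 1) := by
      rw [PlaceOver.ord_neg, PlaceOver.ord_algebraMap_holds P one_ne_zero]; exact h
    have h2 := P.ord_add_eq_left_of_lt hf (neg_ne_zero.2 ((_root_.map_ne_zero _).2 one_ne_zero))
      hlt
    rw [← sub_eq_add_neg, ← h1] at h2
    exact h2.2
  have hzero : 0 < P.ord (f - 1) → P.ord f = 0 := fun h ↦ by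
    have hlt : P.ord (1 : F) < P.ord (f - 1) := by rw [h1ord]; exact h
    have h2 := P.ord_add_eq_left_of_lt one_ne_zero hf1 hlt
    rw [add_sub_cancel] at h2
    rw [h2.2, h1ord]
  refine ⟨⟨fun h ↦ ?_, fun h ↦ ?_⟩, ⟨fun h ↦ ?_, fun h ↦ ?_⟩⟩
  · rw [hord] at h
    rcases lt_trichotomy (P.ord f) 0 with hn | h0 | hp
    · rw [hneg hn] at h; omega
    · have hmem : f - 1 ∈ P.toValuationSubring :=
        sub_mem ((P.mem_toValuationSubring_iff_ord_nonneg hf).2 h0.ge) (one_mem _)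
      have := (P.mem_toValuationSubring_iff_ord_nonneg hf1).1 hmem
      omega
    · exact hp
  · rw [hord, hpos h]; omega
  · rw [hord] at h
    rcases lt_trichotomy (P.ord f) 0 with hn | h0 | hp
    · rw [hneg hn] at h; omega
    · rw [h0] at h; omega
    · rw [hpos hp] at h; omega
  · rw [hord, hzero h]; omega

variable [IsAlgFunctionField K' F] [IsAlgClosed K'] [CharZero K']

/-- **The `S₃`-arrangement**: a degree-`4` Belyi function on a genus-one function field can be
replaced (by `f`, `1 - f` or `1 - 1/f`) by one whose fibres over `∞` and over `0` are single
places. [cite: Zapponi2009BelyiDegree, Example 1.2] -/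
theorem exists_arranged {f : F} (hf : IsBelyiFunction K' f) (hg : genus K' F = 1)
    (hd : Module.finrank K'⟮f⟯ F = 4) :
    ∃ g : F, IsBelyiFunction K' g ∧ Module.finrank K'⟮g⟯ F = 4 ∧
      (∀ P Q : PlaceOver K' F, P.ord g < 0 → Q.ord g < 0 → P = Q) ∧
      (∀ P Q : PlaceOver K' F, 0 < P.ord g → 0 < Q.ord g → P = Q) := by
  classical
  have hf0 : f ≠ 0 := fun h0 ↦ hf.1 ⟨0, by rw [map_zero, h0]⟩
  have hf1 : f - 1 ≠ 0 := fun h0 ↦ hf.1 ⟨1, by rw [map_one]; exact (sub_eq_zero.1 h0).symm⟩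
  set U₀ : Finset (PlaceOver K' F) :=
    (finite_setOf_ord_ne_zero_holds (K := K') hf0).toFinset.filter fun P ↦ 0 < P.ord f with hU₀
  set U₁ : Finset (PlaceOver K' F) :=
    (finite_setOf_ord_ne_zero_holds (K := K') hf1).toFinset.filter fun P ↦ 0 < P.ord (f - 1)
    with hU₁
  set Ui : Finset (PlaceOver K' F) :=
    (finite_setOf_ord_ne_zero_holds (K := K') hf0).toFinset.filter fun P ↦ P.ord f < 0 with hUi
  have hm₀ : ∀ P, P ∈ U₀ ↔ 0 < P.ord f := fun P ↦ by
    rw [hU₀, Finset.mem_filter, Set.Finite.mem_toFinset, Set.mem_setOf_eq]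
    exact ⟨fun h ↦ h.2, fun h ↦ ⟨h.ne', h⟩⟩
  have hm₁ : ∀ P, P ∈ U₁ ↔ 0 < P.ord (f - 1) := fun P ↦ by
    rw [hU₁, Finset.mem_filter, Set.Finite.mem_toFinset, Set.mem_setOf_eq]
    exact ⟨fun h ↦ h.2, fun h ↦ ⟨h.ne', h⟩⟩
  have hmi : ∀ P, P ∈ Ui ↔ P.ord f < 0 := fun P ↦ by
    rw [hUi, Finset.mem_filter, Set.Finite.mem_toFinset, Set.mem_setOf_eq]
    exact ⟨fun h ↦ h.2, fun h ↦ ⟨h.ne, h⟩⟩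
  obtain ⟨hcard, -, hc₀, hc₁, hci⟩ := fibres_of_finrank_eq_four hf hg hd U₀ U₁ Ui hm₀ hm₁ hmi
  -- uniqueness from a one-element fibre
  have huniq : ∀ (U : Finset (PlaceOver K' F)) (p : PlaceOver K' F → Prop), (∀ P, P ∈ U ↔ p P) →
      U.card = 1 → ∀ P Q, p P → p Q → P = Q := by
    intro U p hU h1 P Q hP hQ
    obtain ⟨R, hR⟩ := Finset.card_eq_one.1 h1
    have hP' := (hU P).2 hP; have hQ' := (hU Q).2 hQ
    rw [hR, Finset.mem_singleton] at hP' hQ'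
    rw [hP', hQ']
  by_cases h₁2 : U₁.card = 2
  · -- `g = f`
    exact ⟨f, hf, hd, huniq Ui _ hmi (by omega), huniq U₀ _ hm₀ (by omega)⟩
  by_cases h₀2 : U₀.card = 2
  · -- `g = 1 - f`: poles of `f`, zeros of `f - 1`
    refine ⟨1 - f, hf.one_sub, by rw [finrank_adjoin_one_sub, hd], ?_, ?_⟩
    · intro P Q hP hQ
      have key : ∀ R : PlaceOver K' F, R.ord (1 - f) < 0 → R.ord f < 0 := fun R hR ↦ by
        rw [show (1 : F) - f = -(f - algebraMap K' F 1) by rw [map_one]; ring,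
          PlaceOver.ord_neg] at hR
        exact (ord_sub_algebraMap_neg_iff R hf0 (by rw [map_one]; exact hf1)).1 hR
      exact huniq Ui _ hmi (by omega) P Q (key P hP) (key Q hQ)
    · intro P Q hP hQ
      have key : ∀ R : PlaceOver K' F, 0 < R.ord (1 - f) → 0 < R.ord (f - 1) := fun R hR ↦ by
        rwa [show (1 : F) - f = -(f - 1) by ring, PlaceOver.ord_neg] at hR
      exact huniq U₁ _ hm₁ (by omega) P Q (key P hP) (key Q hQ)
  · -- `g = 1 - 1/f`: poles = zeros of `f`, zeros = zeros of `f - 1`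
    have hi2 : Ui.card = 2 := by omega
    refine ⟨1 - f⁻¹, hf.inv.one_sub, by rw [finrank_adjoin_one_sub, finrank_adjoin_inv, hd], ?_, ?_⟩
    · intro P Q hP hQ
      exact huniq U₀ _ hm₀ (by omega) P Q ((ord_one_sub_inv P hf0 hf1).1.1 hP)
        ((ord_one_sub_inv Q hf0 hf1).1.1 hQ)
    · intro P Q hP hQ
      exact huniq U₁ _ hm₁ (by omega) P Q ((ord_one_sub_inv P hf0 hf1).2.1 hP)
        ((ord_one_sub_inv Q hf0 hf1).2.1 hQ)

end Arrange








/-! ### §4 The theorem -/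

section Main

variable {K : Type u} [Field K] [CharZero K]

omit [CharZero K] in
/-- From the identity over `K̄` to `j` over `K`: `c₄³ = 1728 Δ ⇒ j = 1728`. [folklore] -/
theorem j_eq_1728_of_c₄_cube (W : WeierstrassCurve K) [W.IsElliptic]
    (h : (W.baseChange (AlgebraicClosure K)).c₄ ^ 3 =
      1728 * (W.baseChange (AlgebraicClosure K)).Δ) : W.j = 1728 := by
  rw [WeierstrassCurve.baseChange, WeierstrassCurve.map_c₄, WeierstrassCurve.map_Δ, ← map_pow,
    ← map_ofNat (algebraMap K (AlgebraicClosure K)) 1728, ← map_mul] at h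
  have h' := (algebraMap K (AlgebraicClosure K)).injective h
  have hΔ : (W.Δ'⁻¹ : Kˣ) * W.Δ = 1 := by
    rw [← WeierstrassCurve.coe_Δ', Units.inv_mul]
  rw [WeierstrassCurve.j]
  linear_combination (↑W.Δ'⁻¹ : K) * h' + (1728 : K) * hΔ

/-- From the identity over `K̄` to `j` over `K`: `6561 c₄³ = 207646 Δ ⇒ j = 207646/6561`.
[folklore] -/
theorem j_eq_of_c₄_cube (W : WeierstrassCurve K) [W.IsElliptic]
    (h : 6561 * (W.baseChange (AlgebraicClosure K)).c₄ ^ 3 =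
      207646 * (W.baseChange (AlgebraicClosure K)).Δ) :
    W.j = 207646 / 6561 := by
  rw [WeierstrassCurve.baseChange, WeierstrassCurve.map_c₄, WeierstrassCurve.map_Δ, ← map_pow,
    ← map_ofNat (algebraMap K (AlgebraicClosure K)) 6561,
    ← map_ofNat (algebraMap K (AlgebraicClosure K)) 207646, ← map_mul, ← map_mul] at h
  have h' := (algebraMap K (AlgebraicClosure K)).injective h
  have hΔ : (W.Δ'⁻¹ : Kˣ) * W.Δ = 1 := by
    rw [← WeierstrassCurve.coe_Δ', Units.inv_mul]
  rw [WeierstrassCurve.j]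
  linear_combination (↑W.Δ'⁻¹ / 6561 : K) * h' + (207646 / 6561 : K) * hΔ

variable (W : WeierstrassCurve K) [W.IsElliptic]

/-- **An elliptic curve with a Belyi function of degree `4` has `j = 1728` or `j = 207646/6561`**
(`E/K`, `char K = 0`, Belyi functions of `K̄(E)` over `K̄ = AlgebraicClosure K`). With
`belyiDegree_eq_four_of_j_eq_1728` and `belyiDegree_ne_three_of_j_ne_zero` of
`BelyiDegreeThreeJZero` this is the implication "⇒" of Zapponi's classification of the curves of
Belyi degree `4`.
[cite: Zapponi2009BelyiDegree, Example 1.2] -/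
theorem j_eq_of_isBelyiFunction_of_finrank_eq_four {f : W.geomFunctionField}
    (hf : IsBelyiFunction (AlgebraicClosure K) f)
    (hd : Module.finrank (AlgebraicClosure K)⟮f⟯ W.geomFunctionField = 4) :
    W.j = 1728 ∨ W.j = 207646 / 6561 := by
  classical
  haveI : CharZero (AlgebraicClosure K) :=
    charZero_of_injective_algebraMap (algebraMap K (AlgebraicClosure K)).injective
  have hgen : genus (AlgebraicClosure K) W.geomFunctionField = 1 :=
    genus_functionField_weierstrass_holds _ (W.baseChange (AlgebraicClosure K)).toAffine
  -- Step 1: arrange singleton fibres over `∞` and `0`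
  obtain ⟨g, hg, hgd, hpole1, hzero1⟩ := exists_arranged hf hgen hd
  have hg0 : g ≠ 0 := fun h0 ↦ hg.1 ⟨0, by rw [map_zero, h0]⟩
  have hg1 : g - 1 ≠ 0 := fun h0 ↦ hg.1 ⟨1, by rw [map_one]; exact (sub_eq_zero.1 h0).symm⟩
  -- Step 2: the fibres of `g`
  set U₀ : Finset (PlaceOver (AlgebraicClosure K) W.geomFunctionField) :=
    (finite_setOf_ord_ne_zero_holds (K := AlgebraicClosure K) hg0).toFinset.filter
      fun P ↦ 0 < P.ord g with hU₀
  set U₁ : Finset (PlaceOver (AlgebraicClosure K) W.geomFunctionField) :=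
    (finite_setOf_ord_ne_zero_holds (K := AlgebraicClosure K) hg1).toFinset.filter
      fun P ↦ 0 < P.ord (g - 1) with hU₁
  set Ui : Finset (PlaceOver (AlgebraicClosure K) W.geomFunctionField) :=
    (finite_setOf_ord_ne_zero_holds (K := AlgebraicClosure K) hg0).toFinset.filter
      fun P ↦ P.ord g < 0 with hUi
  have hm₀ : ∀ P, P ∈ U₀ ↔ 0 < P.ord g := fun P ↦ by
    rw [hU₀, Finset.mem_filter, Set.Finite.mem_toFinset, Set.mem_setOf_eq]
    exact ⟨fun h ↦ h.2, fun h ↦ ⟨h.ne', h⟩⟩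
  have hm₁ : ∀ P, P ∈ U₁ ↔ 0 < P.ord (g - 1) := fun P ↦ by
    rw [hU₁, Finset.mem_filter, Set.Finite.mem_toFinset, Set.mem_setOf_eq]
    exact ⟨fun h ↦ h.2, fun h ↦ ⟨h.ne', h⟩⟩
  have hmi : ∀ P, P ∈ Ui ↔ P.ord g < 0 := fun P ↦ by
    rw [hUi, Finset.mem_filter, Set.Finite.mem_toFinset, Set.mem_setOf_eq]
    exact ⟨fun h ↦ h.2, fun h ↦ ⟨h.ne, h⟩⟩
  obtain ⟨hcard, ⟨s0, s1, si⟩, hc₀, hc₁, hci⟩ :=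
    fibres_of_finrank_eq_four hg hgen hgd U₀ U₁ Ui hm₀ hm₁ hmi
  have hci1 : Ui.card = 1 := by
    refine le_antisymm (Finset.card_le_one.2 fun P hP Q hQ ↦ hpole1 P Q ((hmi P).1 hP)
      ((hmi Q).1 hQ)) hci
  have hc₀1 : U₀.card = 1 := by
    refine le_antisymm (Finset.card_le_one.2 fun P hP Q hQ ↦ hzero1 P Q ((hm₀ P).1 hP)
      ((hm₀ Q).1 hQ)) hc₀
  have hc₁2 : U₁.card = 2 := by omega
  obtain ⟨Qi, hQi⟩ := Finset.card_eq_one.1 hci1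
  obtain ⟨Q₀, hQ₀⟩ := Finset.card_eq_one.1 hc₀1
  obtain ⟨Q₁, Q₂, hQ12, hQ⟩ := Finset.card_eq_two.1 hc₁2
  rw [hQi, Finset.sum_singleton] at si
  rw [hQ₀, Finset.sum_singleton] at s0
  rw [hQ, Finset.sum_pair hQ12] at s1
  have hQi' : Qi.ord g < 0 := (hmi Qi).1 (by rw [hQi]; exact Finset.mem_singleton_self _)
  have hQ₁' : 0 < Q₁.ord (g - 1) := (hm₁ Q₁).1 (by rw [hQ]; simp)
  have hQ₂' : 0 < Q₂.ord (g - 1) := (hm₁ Q₂).1 (by rw [hQ]; simp)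
  -- Step 3: points and the translation by the pole
  obtain ⟨S, hS⟩ := place_surjective (W := W) Qi
  obtain ⟨S₀, hS₀⟩ := place_surjective (W := W) Q₀
  obtain ⟨S₁, hS₁⟩ := place_surjective (W := W) Q₁
  obtain ⟨S₂, hS₂⟩ := place_surjective (W := W) Q₂
  set f' : W.geomFunctionField := W.transAlgEquiv S g with hf'
  have hf'ne : f' ≠ 0 := by rw [hf']; exact (_root_.map_ne_zero _).2 hg0
  have hord' : ∀ R : W.geomPoints, W.ordAt R f' = W.ordAt (R + S) g := fun R ↦ by
    rw [hf', transAlgEquiv_apply, ordAt_transAlgHom]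
  have hord1' : ∀ R : W.geomPoints, W.ordAt R (f' - 1) = W.ordAt (R + S) (g - 1) := fun R ↦ by
    rw [hf', ← ordAt_transAlgHom, map_sub, map_one, transAlgEquiv_apply]
  have hf'0 : W.ordAt 0 f' = -4 := by
    rw [hord', zero_add, ordAt_eq_ord_place S hg0, hS]; omega
  have hreg : ∀ R : W.geomPoints, R ≠ 0 → 0 ≤ W.ordAt R f' := by
    intro R hR
    rw [hord']
    by_contra hneg
    push Not at hneg
    rw [ordAt_eq_ord_place _ hg0] at hneg
    have h1 := hpole1 _ _ hneg hQi'
    rw [← hS] at h1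
    exact hR (add_eq_right.1 (place_injective h1))
  -- Step 4: `f' = a + b x + c y + d x²`
  obtain ⟨a, b, c, d, hd0, hfeq⟩ := exists_eq_quad_of_ordAt_eq_neg_four hf'ne hreg hf'0
  -- Step 5: the zero `P₀ = S₀ - S`
  have hP00 : S₀ - S ≠ 0 := by
    intro h0
    have hS0S : S₀ = S := sub_eq_zero.1 h0
    rw [hS0S, hS] at hS₀
    rw [← hS₀] at s0
    omega
  obtain ⟨e₀, b₀, h₀, hP₀⟩ := geomPoints.exists_eq_some hP00
  have hzP : W.ordAt (.some e₀ b₀ h₀) f' = 4 := by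
    rw [← hP₀, hord', sub_add_cancel, ordAt_eq_ord_place S₀ hg0, hS₀, s0]
  have hz : ∀ R : W.geomPoints, R ≠ 0 → 0 < W.ordAt R f' → R = .some e₀ b₀ h₀ := by
    intro R hR hpos
    rw [hord', ordAt_eq_ord_place _ hg0] at hpos
    have h1 := hzero1 _ _ hpos (by omega : 0 < Q₀.ord g)
    rw [← hS₀] at h1
    have h2 : R + S = S₀ := place_injective h1
    rw [← hP₀, ← h2, add_sub_cancel_right]
  -- Step 6: the fibre over `1`: `R₁ = S₁ - S ≠ R₂ = S₂ - S`
  have hQipole : Qi.ord (g - 1) < 0 := by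
    rw [show g - 1 = g - algebraMap (AlgebraicClosure K) W.geomFunctionField 1 by rw [map_one]]
    exact (ord_sub_algebraMap_neg_iff Qi hg0 (by rw [map_one]; exact hg1)).2 hQi'
  have hR0 : ∀ {T : W.geomPoints} {Q : PlaceOver (AlgebraicClosure K) W.geomFunctionField},
      W.place T = Q → 0 < Q.ord (g - 1) → T - S ≠ 0 := by
    intro T Q hT hQ h0
    have hTS : T = S := sub_eq_zero.1 h0
    rw [hTS, hS] at hT
    rw [← hT] at hQ
    omega
  obtain ⟨α, c₁, h₁, hR₁⟩ := geomPoints.exists_eq_some (hR0 hS₁ hQ₁')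
  obtain ⟨β, c₂, h₂, hR₂⟩ := geomPoints.exists_eq_some (hR0 hS₂ hQ₂')
  have hne12 : (Affine.Point.some α c₁ h₁ : W.geomPoints) ≠ .some β c₂ h₂ := by
    rw [← hR₁, ← hR₂]
    intro h
    have : S₁ = S₂ := sub_left_injective h
    apply hQ12
    rw [← hS₁, ← hS₂, this]
  have hv : ∀ {T : W.geomPoints} {Q : PlaceOver (AlgebraicClosure K) W.geomFunctionField},
      W.place T = Q → W.ordAt (T - S) (f' - 1) = Q.ord (g - 1) := by
    intro T Q hT
    rw [hord1', sub_add_cancel, ordAt_eq_ord_place T hg1, hT]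
  have hv₁ : W.ordAt (.some α c₁ h₁) (f' - 1) = (Q₁.ord (g - 1)).toNat := by
    rw [← hR₁, hv hS₁, Int.toNat_of_nonneg hQ₁'.le]
  have hv₂ : W.ordAt (.some β c₂ h₂) (f' - 1) = (Q₂.ord (g - 1)).toNat := by
    rw [← hR₂, hv hS₂, Int.toNat_of_nonneg hQ₂'.le]
  have hn₁ : 1 ≤ (Q₁.ord (g - 1)).toNat := by omega
  have hn₂ : 1 ≤ (Q₂.ord (g - 1)).toNat := by omega
  have hsum : (Q₁.ord (g - 1)).toNat + (Q₂.ord (g - 1)).toNat = 4 := by omega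
  have ho : ∀ R : W.geomPoints, R ≠ 0 → 0 < W.ordAt R (f' - 1) →
      R = .some α c₁ h₁ ∨ R = .some β c₂ h₂ := by
    intro R hR hpos
    rw [hord1', ordAt_eq_ord_place _ hg1] at hpos
    have hmem := (hm₁ _).2 hpos
    rw [hQ, Finset.mem_insert, Finset.mem_singleton] at hmem
    rcases hmem with h | h
    · left
      rw [← hS₁] at h
      rw [← hR₁, ← place_injective h, add_sub_cancel_right]
    · right
      rw [← hS₂] at h
      rw [← hR₂, ← place_injective h, add_sub_cancel_right]
  -- Step 7: the two cases
  rw [hfeq] at hf'0 hzP hz hv₁ hv₂ ho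
  by_cases hc : c = 0
  · left
    rw [hc, map_zero, zero_mul, add_zero] at hf'0 hzP hz hv₁ hv₂ ho
    exact j_eq_1728_of_c₄_cube W (c₄_cube_eq_of_sq (W := W) hd0 h₀ (.some α c₁ h₁)
      (.some β c₂ h₂) hz ho)
  · right
    exact j_eq_of_c₄_cube W (c₄_cube_eq_of_quad_f (W := W) hc hd0 h₀ h₁ h₂ hf'0 hzP hz hne12
      hn₁ hn₂ hsum hv₁ hv₂ ho)

/-- **`deg_B(E) = 4 ⇒ j(E) ∈ {1728, 207646/6561}`.** [cite: Zapponi2009BelyiDegree, Example 1.2] -/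
theorem j_eq_of_belyiDegree_eq_four
    (h4 : belyiDegree (AlgebraicClosure K) W.geomFunctionField = 4) :
    W.j = 1728 ∨ W.j = 207646 / 6561 := by
  have hex : ∃ f : W.geomFunctionField, IsBelyiFunction (AlgebraicClosure K) f := by
    by_contra hne
    push Not at hne
    rw [belyiDegree_eq_zero_of_forall_not hne] at h4
    exact absurd h4 (by norm_num)
  obtain ⟨f, hf, hfd⟩ := exists_finrank_eq_belyiDegree hex
  exact j_eq_of_isBelyiFunction_of_finrank_eq_four W hf (hfd.trans h4)

/-! ### The setting of the named fact: any algebraic closure, number fields (appended) -/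

/-- **`deg_B(E_Ω) = 4 ⇒ j(E) ∈ {1728, 207646/6561}`** for every algebraic closure `Ω` of `K`
(`belyiDegree_baseChange_eq_geom` of `BelyiTransportSemilinear`).
[cite: Zapponi2009BelyiDegree, Example 1.2] -/
theorem j_eq_of_belyiDegree_baseChange_eq_four (K : Type) [Field K] [CharZero K]
    (W : WeierstrassCurve K) [W.IsElliptic] (Ω : Type) [Field Ω] [Algebra K Ω] [IsAlgClosure K Ω]
    (h4 : belyiDegree Ω (W.baseChange Ω).toAffine.FunctionField = 4) :
    W.j = 1728 ∨ W.j = 207646 / 6561 := by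
  rw [belyiDegree_baseChange_eq_geom K W Ω] at h4
  exact j_eq_of_belyiDegree_eq_four W h4

/-- **Zapponi's list for elliptic curves over a number field: `deg_B(E_Ω) ≤ 4 ⇒
j(E) ∈ {0, 1728, 207646/6561}`** (`deg_B ≥ 3` by Belyi's theorem and `2g + 1 ≤ deg_B`,
`three_le_belyiDegree_baseChange`; `= 3 ⇒ j = 0`, `BelyiDegreeThreeJZero`; `= 4 ⇒` this file).
In particular Javanpeykar's bound `h_F(E) ≤ 13·10⁶ deg_B(E_Ω)⁵` is `≥ 13·10⁶·5⁵` off these three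
`j`-invariants. [cite: Zapponi2009BelyiDegree, Example 1.2] -/
theorem j_mem_of_belyiDegree_baseChange_le_four (K : Type) [Field K] [NumberField K]
    (W : WeierstrassCurve K) [W.IsElliptic] (Ω : Type) [Field Ω] [Algebra K Ω] [IsAlgClosure K Ω]
    (h4 : belyiDegree Ω (W.baseChange Ω).toAffine.FunctionField ≤ 4) :
    W.j = 0 ∨ W.j = 1728 ∨ W.j = 207646 / 6561 := by
  have h3 := three_le_belyiDegree_baseChange K W Ω
  by_cases hj : W.j = 0
  · exact Or.inl hj
  · right
    have hne3 : belyiDegree Ω (W.baseChange Ω).toAffine.FunctionField ≠ 3 := fun h ↦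
      hj ((belyiDegree_baseChange_eq_three_iff_j_eq_zero K W Ω).1 h)
    exact j_eq_of_belyiDegree_baseChange_eq_four K W Ω (by omega)

/-- Equivalently: **`j(E) ∉ {0, 1728, 207646/6561} ⇒ deg_B(E_Ω) ≥ 5`**, so that the right-hand
side of `javanpeykar2014_stableFaltingsHeight_le` is `≥ 13·10⁶·3125` for such curves.
[cite: Javanpeykar2014, Thm. 1.1.1] -/
theorem five_le_belyiDegree_baseChange (K : Type) [Field K] [NumberField K]
    (W : WeierstrassCurve K) [W.IsElliptic] (Ω : Type) [Field Ω] [Algebra K Ω] [IsAlgClosure K Ω]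
    (h0 : W.j ≠ 0) (h1728 : W.j ≠ 1728) (h' : W.j ≠ 207646 / 6561) :
    5 ≤ belyiDegree Ω (W.baseChange Ω).toAffine.FunctionField := by
  by_contra hlt
  push Not at hlt
  rcases j_mem_of_belyiDegree_baseChange_le_four K W Ω (by omega) with h | h | h
  · exact h0 h
  · exact h1728 h
  · exact h' h

end Main


end BelyiDegreeFourJ

end Literature.NumberTheory.DiophantineGeometry

end
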